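import Summits.AnomalousDissipation.AnomalousDissipation.Theorems.SolenoidalFractalHomogenisationLagrangianStepCellLawVSectorialOn
import Summits.AnomalousDissipation.AnomalousDissipation.Theorems.SolenoidalFractalHomogenisationLagrangianStepCellClauseCutsFamily
import Summits.AnomalousDissipation.AnomalousDissipation.Theorems.SolenoidalFractalHomogenisationLagrangianStepCellLawVQSPinch
import Summits.AnomalousDissipation.AnomalousDissipation.Theorems.SolenoidalFractalHomogenisationLagrangianStepCellLawVDesignPoint
import Summits.AnomalousDissipation.AnomalousDissipation.Theorems.SolenoidalFractalHomogenisationLagrangianStepCellLawVEvenSlotStep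
import Summits.AnomalousDissipation.AnomalousDissipation.Theorems.SolenoidalFractalHomogenisationLagrangianStepCellLawVEvenCertPointEnclosures
import Summits.AnomalousDissipation.AnomalousDissipation.Theorems.SolenoidalFractalHomogenisationLagrangianStepCellLawVEvenCertEnclosures110
import Summits.AnomalousDissipation.AnomalousDissipation.Theorems.SolenoidalFractalHomogenisationLagrangianStepCellLawVQSOddEven
import HarnessLib

/-!
# K1L_D · IS-half · E1-CERT v2 (final, SORRY-FREE) — certificate for `WCrossing.stub_W_evenSlackB` (even half of obligation W₀, branch B)

Cell `ad-ideate`, seat p5 g12 (planner, lens «profile»), 2026-08-29.  Companion memo `Lines/onelevel-W-evenSlack-cert.md` (v2);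
numerics `evencert.py` (kit **j321011** = constants of record; j320722 = v1; j321065 = unused fallback ℓ̄ = 2·10⁻⁵).
Target (VERBATIM type of `WCrossing.stub_W_evenSlackB`, onelevel_W_crossing.lean v2 f677fdc0e2c7 l.462):

  `∃ a > 0, EvenSlackWindowB a ρB`     (`MB = 1/50`, `ρB = 3/25000`, `ΦB a S = a • excQS cubatureWord MB S`).

## v2 CUT (accepted by prover ad-sawtooth-k1loc-p1 g12, STATUS 2026-08-29T00:04:46Z)

The v1 per-slot stubs `stub_slot_upper/lower` are now THEOREMS (`slot_upper`, `slot_lower`, §3.8), and **THIS FILE IS SORRY-FREE** (v2 final,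
2026-08-29T00:36Z; `#print axioms W_evenSlackB` = `[propext, Classical.choice, Quot.sound]`): the three analytic leaves of the v2 cut are CITED from the
prover files that landed while it was written —
* `stub_oddEven` (§3.3, S2 — matrix level, the load-bearing analytic lemma: for a 3×3 real `B` with `wᵀBw ≥ b|w|²` and `(uᵀBw − wᵀBu)² ≤ 4ω²|u|²|w|²`,
  `|vᵀ f_T(B) v − vᵀ f_T(½(B+Bᵀ)) v| ≤ (ω²/b³)|v|²`, `f_T = qsResp ρ T`) `:= oddEven_qsResp` (`…CellLawVQSOddEven.lean`, p681750, prover ad-sawtooth-k1loc-p1 g12);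
* `stub_N110U`, `stub_N110L` (§3.3: affine enclosures of the closed-form scalar response `f_{T₁₁₀}` on an interval) `:= encl_N110U / encl_N110L`
  (`…CellLawVEvenCertEnclosures110.lean`, p1 g12);
* the four POINT enclosures N100U/L, N111U/L `:= WEvenCertN.stub_N1xx*` (`…CellLawVEvenCertPointEnclosures.lean`, p681593, prover ad-k1loc-p3 g7).

## The reduction (what this file PROVES, kernel-checked)

* STRUCTURE.  `symb (excQS W M S)(k,p) = Σ_s slotCoef_s (e_s·k)² · pᵀQ_s(S)p` (`symb_excQS`), `Q_s = f_{T_s}(B̂(S,m̂_s))·P_s`; for the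
  cubature word `slotCoef_s (e_s·k)² = τ_s (v_s·k)²/(n_s |m_s|⁴) / (2(2π)⁴·3720)` (`slotCoef_mul_sq`, exact).
* CENTRE.  `Sc = isoVisc 1 + κc • Δ4`, `κc = −15851083/5·10⁹` (rational rounding of the computed `O_h`-invariant fixed shape; residual `8·10⁻¹³`
  inside the rounding slack).  `symb Sc (k,p) = |k|²|p|² + κc Σ_c k_c²p_c²`; `NearIso Sc sloC 1`, `sloC = 1 + κc/2`.
* PER-SLOT BOUNDS (§3, PROVED modulo the three stubs).  For `Sc/λ ≼ S ≼ λSc` (`λ ∈ [λ₀, Λ_w]`), `OddSectorial S τ`, `τ ≤ τ₀ = 1/200`: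
  `lForm_s(p)/λ ≤ pᵀQ_s(S)p ≤ (λ/λ₀)·uForm_s(p)`.  Chain: (i) MAJOR SYMMETRISATION `S ↦ ½(S + Sᵀ)` (same transverse symbol ⇒ same order interval,
  `OddSmall _ 0`, block `½(B̂+B̂ᵀ)`; §3.1) + S2 with `b = sloC/λ`, `ω = τλ/2` (skew bound `regBlock_skew` from `OddSectorial` + the block ceiling) and the
  flat charge `ω²/b³ ≤ τ₀²Λ_w⁵/(4 sloC³) ≤ ℓ̄ = 10⁻⁵` (`oddCharge_le`); (ii) symmetric part: block relaxation `B̂(Sc)/λ ≼ B̂(S_sym) ≼ λB̂(Sc)`, floor/ceiling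
  (prover's `CellLawVEvenSlotStep`, p680474); scalar classes {100} (`α = 1`), {111} (`α = 1 + κc/3`): pinch `slotForm_le/ge_of_inInterval` + the ray
  monotonicity `λ ↦ f(α/λ)/λ ↓`, `λ ↦ λ f(λα) ↑` (`CellLawVSlotWeightMonotone`) + point enclosures at `λ₀`; class {110} (block `diag(1, β_d)`,
  `β_d = sloC`): PER-EIGENVALUE step in the eigenbasis of `B̂(S_sym)` (Mathlib spectral theorem; §3.4): UPPER `f(γ) = λu·g(λ₀u)/(λ₀u)`-type ray bound +
  affine majorant `A + B u` in `u = 1/(λγ)` + the inverse-form identity `2v·w − wᵀBw ≤ vᵀB⁻¹v`-free SOS (`hY`), LOWER ray bound + affine minorant in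
  `x = γ/λ` + `vᵀB̂(S_sym)v ≤ λ·symb Sc`; explicit polar frame `z ⊥ m`, `z × m` per face diagonal (§3.7–3.8, slot table by `fin_cases`).
* FINITE CORE (§5, proved).  `O_h`-invariant biquadratic forms `a₁I₁ + a₂I₂ + a₃I₃`, transverse reduction `I₃ = −I₁`, `0 ≤ I₁ ≤ I₂`; the 26-slot sums are
  such forms with coefficients linear in the class constants (`slot_sum_poly`, `ring`); four SIGN CONDITIONS on rationals (`norm_num`).  Constants of
  record (j321011, τ₀ = 1/200, ℓ̄ = 10⁻⁵, σ = 10⁻⁷, den 10¹⁰): margins U `cA = 4.848·10⁻⁵, cA+cB = 2.46·10⁻⁴`; L `cA = 4.849·10⁻⁵, cA+cB = 2.33·10⁻⁴`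
  (per `|k|²|p|²`, beyond `δ = 1/8000`), `λ₀ = 26/25`, `Λ_V = 21/20`, `Λ_w = Λ_Vλ₀/sloC = 1.0937`, `a = aHat·2(2π)⁴·3720`, `aHat = 8946415019/5·10¹¹`.
* WINDOW ARITHMETIC (§6, proved): all numeric side conditions of `EvenSlackWindowB` incl. the τ-floor `3.9066·10⁻³ ≤ τ₀`.

Sorries: NONE.  Items: K1L_D = stmt-AnomalousDissipation-27980 (route 1), crux dir stmt-…-24912.

IMPORT NOTE.  The line module `…Cruxes.LagrangianRenormalisationStep.Lines.onelevel_W_crossing` is not importable on the farm (Cruxes modules are not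
built: `remote:stale:unbuilt`), so §W below carries VERBATIM COPIES of the five `WCrossing` definitions this certificate is stated over
(`EvenSlackOnInterval` l.197, `MB` l.413, `ρB` l.418, `ΦB` l.423, `EvenSlackWindowB` l.442 of onelevel_W_crossing.lean v2, f677fdc0e2c7), with the same
names; the imports/`open`s are those of the line file (+ the two prover files above).  Hence `W_evenSlackB` below is token-identical to
`WCrossing.stub_W_evenSlackB`: once §0–§6 live in a Theorems module, `theorem stub_W_evenSlackB := WEvenCert.W_evenSlackB` closes the line's stub BY DEFEQ
(verified: this file prepended to onelevel_W_crossing.lean v2 with that one-liner elaborates, rc 0).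
-/

set_option linter.dupNamespace false
set_option linter.unusedVariables false

namespace Summit.AnomalousDissipation.AnomalousDissipation.Cruxes.LagrangianRenormalisationStep.WEvenCert

open Summit.AnomalousDissipation.AnomalousDissipation.Theorems
open Summit.AnomalousDissipation.AnomalousDissipation.Theorems.SolenoidalFractalHomogenisation.LagrangianStep
open Literature.Analysis Literature.Analysis.FluidPDE Literature.Analysis.FunctionSpaces
open Literature.Algebra.EuclideanLattices (norm_sq_fin_three)
open Set Real

noncomputable section


/-! ## §W Verbatim copies of the `WCrossing` definitions (see IMPORT NOTE) -/

/-- [verbatim copy of `WCrossing.EvenSlackOnInterval`] The EVEN HALF WITH SLACK `δ ≥ 0` for the design map: the image lands in the interval SHRUNK by `1+δ`. -/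
def EvenSlackOnInterval (Φ₀ : T4 → T4) (Sstar : T4) (lam₀ Λ τ₀ δ : ℝ) : Prop :=
  ∀ lam ∈ Set.Icc lam₀ Λ, ∀ S : T4, ∀ τ ∈ Set.Icc 0 τ₀, InInterval Sstar lam S → OddSectorial S τ → InInterval Sstar (lam / (1 + δ)) (Φ₀ S)

/-- [verbatim copy of `WCrossing.MB`] Branch-B relaxation parameter `M_B = 1/50`. -/
def MB : ℝ := 1 / 50

/-- [verbatim copy of `WCrossing.ρB`] The residue budget of D1 in `RelSmall` currency, variant A: `1.2·10⁻⁴`. -/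
def ρB : ℝ := 3 / 25000

/-- [verbatim copy of `WCrossing.ΦB`] The normalised quasi-static design map at branch B. -/
def ΦB (a : ℝ) : T4 → T4 := fun S => a • excQS cubatureWord MB S

/-- [verbatim copy of `WCrossing.EvenSlackWindowB`] The EVEN-ONLY form of obligation W₀ at branch B. -/
def EvenSlackWindowB (a : ℝ) (ρ : ℝ) : Prop :=
  ∃ Sstar : T4, ∃ slo shi lam₀ Λ Λc ΛV τ₀ δ : ℝ,
    Torus.NearIso Sstar slo shi ∧ 0 < slo ∧ slo ≤ 1 ∧ 1 ≤ shi ∧ 1 ≤ lam₀ ∧ InInterval Sstar lam₀ (Torus.isoVisc 1) ∧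
    0 ≤ δ ∧ 1 ≤ (1 - ρ) * (1 + δ) ∧ 93 / 100 + ρ < 1 ∧ lam₀ ≤ Λc ∧ 1 < ΛV ∧ ΛV * Λc * shi ≤ Λ * slo ∧
    shi * Λ ≤ 11 / 10 ∧ 10 / 11 * Λ ≤ slo ∧ shi * Λc * ΛV ≤ 11 / 10 ∧ 10 / 11 * ΛV ≤ slo / Λc ∧
    (0 + 2 * ρ) / (1 - ρ - 93 / 100) * ΛV * (shi * Λc) / (slo / Λc) ≤ τ₀ ∧ τ₀ ≤ 1 / 20 ∧
    EvenSlackOnInterval (ΦB a) Sstar lam₀ Λ τ₀ δ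

/-! ## §0 Certificate data (exact rationals; `evencert.py`, kit j321011, τ₀ = 1/200, flat sectorial charge ℓ̄ = 10⁻⁵, directed rounding to 10⁻¹⁰ plus a deliberate slack σ = 10⁻⁷ on every enclosure) -/

/-- centre anisotropy `κ̃` (rounded fixed point of the `O_h`-invariant power iteration). -/
def κc : ℝ := (-15851083 : ℝ) / 5000000000
/-- reduced normalisation `â = a/(2(2π)⁴·3720)`. -/
def aHat : ℝ := (8946415019 : ℝ) / 500000000000
/-- the normalisation `a` of `ΦB a`. -/
def aB : ℝ := aHat * (2 * (2 * π) ^ 4 * 3720)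
/-- the soft eigenvalue `β_d = 1 + κc/2` of the {110} centre block `diag(1, β_d)` (also `= sloC`). -/
def βd : ℝ := 1 + κc / 2
/-- 1-D ENCLOSURE CONSTANTS (the six `stub_N…` below; memo §2; each an outward 10⁻¹⁰-rounding with deliberate slack 10⁻⁷ of a closed-form value of
`f_c(x) = qsRespScalar ½ T_c x = ϑ(½, T_c x)/x`, `T_c = 4π²|m_c|²·M_B·τ_c ∈ {31.58, 202.13, 575.60}`):
UPPER `U100p ≥ f₁₀₀(1/λ₀)`, `U111p ≥ f₁₁₁(β₁₁₁/λ₀)` (`β₁₁₁ = 1 + κc/3`), {110} tangent majorant `f₁₁₀(1/(λ₀u)) ≤ UAp + UB·u` on `u ∈ [0.83, 1.002]`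
(`u ↦ f(1/(λ₀u)) = λ₀u·ϑ(T/(λ₀u))` is concave); LOWER `L100p ≤ λ₀f₁₀₀(λ₀)`, `L111p ≤ λ₀f₁₁₁(λ₀β₁₁₁)`, {110} tangent minorant
`LAp + LB·x ≤ λ₀ f₁₁₀(λ₀x)` on `x ∈ [0.83, 1]` (convex).  `ellBar = 10⁻⁵ ≥ τ₀²Λ_w⁵/(4 slo³)` is the flat SECTORIAL CHARGE (`stub_oddEven`). -/
def ellBar : ℝ := (1 : ℝ) / 100000
def U100p : ℝ := (3426015147 : ℝ) / 10000000000
def L100p : ℝ := (3299642599 : ℝ) / 10000000000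
def U111p : ℝ := (867549851 : ℝ) / 2500000000
def L111p : ℝ := (667349421 : ℝ) / 2000000000
def UAp : ℝ := (431533 : ℝ) / 2000000000
def UB : ℝ := (865856429 : ℝ) / 2500000000
def LAp : ℝ := (1667097253 : ℝ) / 2500000000
def LB : ℝ := (-1667975517 : ℝ) / 5000000000
/-- window numbers: `λ₀ = Λc`, `Λ_V`, `slo = 1 + κc/2`, `shi = 1`, `Λ = Λ_w = Λ_V λ₀ shi/slo`, `δ`, `τ₀`. -/
def lam0 : ℝ := 26 / 25
def LamV : ℝ := 21 / 20
def sloC : ℝ := (9984148917 : ℝ) / 10000000000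
def LamW : ℝ := (3640000000 : ℝ) / 3328049639
def δc : ℝ := 1 / 8000
def τ0c : ℝ := 1 / 200
/-- PRIMARY CLASS CONSTANTS of the per-slot bounds (`slot_upper`/`slot_lower`): the enclosure constants charged with the sectorial loss,
`U_c = U_c' + ℓ̄`, `L_c = L_c' − Λ_w ℓ̄`. -/
def U100 : ℝ := U100p + ellBar
def U111 : ℝ := U111p + ellBar
def UA : ℝ := UAp + ellBar
def L100 : ℝ := L100p - LamW * ellBar
def L111 : ℝ := L111p - LamW * ellBar
def LA : ℝ := LAp - LamW * ellBar
/-- DERIVED per-class coefficients of the per-slot forms (`uForm`/`lForm` below): `|P p|²`-coefficients per unit `PpM/M` and the {110} `Z`-coefficient.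
{100}: `U100·|Pp|²`; {110}: `UA|Pp|² + UB·(p_z² + p_d²/β_d) = ((UA + UB/β_d)/2)·PpM + UB(1 − 1/β_d)·Z`; {111}: `U111·|Pp|² = (U111/3)·PpM`
(lower: `LA|Pp|² + LB·(p_z² + β_d p_d²)`, etc.). -/
def qA1 : ℝ := U100
def qA2 : ℝ := (UA + UB / βd) / 2
def qA3 : ℝ := U111 / 3
def qB2 : ℝ := UB * (1 - 1 / βd)
def lA1 : ℝ := L100
def lA2 : ℝ := (LA + LB * βd) / 2
def lA3 : ℝ := L111 / 3
def lB2 : ℝ := LB * (1 - βd)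
/-- invariant coefficients of the 26-slot sums (linear in the class constants, `slot_sum_poly`). -/
def u1 : ℝ := 80 * qA1 + 192 * qA2 + 144 * qA3 + 64 * qB2
def u2 : ℝ := 40 * qA1 + 160 * qA2 + 144 * qA3 + 32 * qB2
def u3 : ℝ := 64 * qA2 + 72 * qA3
def l1 : ℝ := 80 * lA1 + 192 * lA2 + 144 * lA3 + 64 * lB2
def l2 : ℝ := 40 * lA1 + 160 * lA2 + 144 * lA3 + 32 * lB2
def l3 : ℝ := 64 * lA2 + 72 * lA3

theorem aHat_pos : 0 < aHat := by unfold aHat; norm_num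
theorem aB_pos : 0 < aB := by unfold aB; have := aHat_pos; positivity
theorem lam0_pos : 0 < lam0 := by unfold lam0; norm_num
theorem sloC_eq : sloC = 1 + κc / 2 := by unfold sloC κc; norm_num
theorem βd_eq_sloC : βd = sloC := by rw [sloC_eq]; rfl

/-! ## §1 The centre `Sc` and the invariant forms -/

/-- `Δ4 i a j b = [i = a = j = b]` (the cubic fourth-order invariant). -/
def Δ4 : T4 := fun i a j b => if i = a ∧ i = j ∧ i = b then 1 else 0

/-- THE CENTRE: `Sc = I + κc Δ4` (O_h-invariant; blocks `I₂` on {100}, `(1+κc/3) I₂` on {111}, `diag(1, 1+κc/2)` on {110}). -/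
def Sc : T4 := Torus.isoVisc 1 + κc • Δ4

/-- `|k|²|p|²`. -/
def Nkp (k p : Fin 3 → ℝ) : ℝ := (k 0 ^ 2 + k 1 ^ 2 + k 2 ^ 2) * (p 0 ^ 2 + p 1 ^ 2 + p 2 ^ 2)
/-- `I₁ = Σ_c k_c² p_c²`. -/
def I1 (k p : Fin 3 → ℝ) : ℝ := k 0 ^ 2 * p 0 ^ 2 + k 1 ^ 2 * p 1 ^ 2 + k 2 ^ 2 * p 2 ^ 2
/-- `I₂ = Σ_{a ≠ b} k_a² p_b²`. -/
def I2 (k p : Fin 3 → ℝ) : ℝ := k 0 ^ 2 * (p 1 ^ 2 + p 2 ^ 2) + k 1 ^ 2 * (p 0 ^ 2 + p 2 ^ 2) + k 2 ^ 2 * (p 0 ^ 2 + p 1 ^ 2)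
/-- `I₃ = Σ_{a ≠ b} k_a k_b p_a p_b`. -/
def I3 (k p : Fin 3 → ℝ) : ℝ := 2 * (k 0 * k 1 * p 0 * p 1 + k 0 * k 2 * p 0 * p 2 + k 1 * k 2 * p 1 * p 2)

theorem Nkp_eq (k p : Fin 3 → ℝ) : Nkp k p = I1 k p + I2 k p := by unfold Nkp I1 I2; ring
theorem I1_nonneg (k p : Fin 3 → ℝ) : 0 ≤ I1 k p := by unfold I1; positivity
theorem I2_nonneg (k p : Fin 3 → ℝ) : 0 ≤ I2 k p := by unfold I2; positivity
theorem Nkp_nonneg (k p : Fin 3 → ℝ) : 0 ≤ Nkp k p := by unfold Nkp; positivity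

theorem dot_eq {k p : Fin 3 → ℝ} (h : ∑ i, p i * k i = 0) : p 0 * k 0 + p 1 * k 1 + p 2 * k 2 = 0 := by
  simpa [Fin.sum_univ_three] using h

/-- On transverse pairs `I₃ = −I₁` (since `I₁ + I₃ = (k·p)²`). [folklore] -/
theorem I3_eq_of_perp {k p : Fin 3 → ℝ} (h : ∑ i, p i * k i = 0) : I3 k p = -I1 k p := by
  have h0 := dot_eq h
  have e : I1 k p + I3 k p = (p 0 * k 0 + p 1 * k 1 + p 2 * k 2) ^ 2 := by unfold I1 I3; ring
  rw [h0] at e; linarith [e, sq_nonneg (0:ℝ)]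

/-- On transverse pairs `I₁ ≤ I₂` (`I₂ − I₁ = Σ_{a<b}(k_a p_b + k_b p_a)² − (k·p)²`). [folklore] -/
theorem I1_le_I2_of_perp {k p : Fin 3 → ℝ} (h : ∑ i, p i * k i = 0) : I1 k p ≤ I2 k p := by
  have h0 := dot_eq h
  have e : I2 k p - I1 k p = (k 0 * p 1 + k 1 * p 0) ^ 2 + (k 0 * p 2 + k 2 * p 0) ^ 2 + (k 1 * p 2 + k 2 * p 1) ^ 2
      - (p 0 * k 0 + p 1 * k 1 + p 2 * k 2) ^ 2 := by unfold I1 I2; ring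
  rw [h0] at e; nlinarith [e, sq_nonneg (k 0 * p 1 + k 1 * p 0), sq_nonneg (k 0 * p 2 + k 2 * p 0), sq_nonneg (k 1 * p 2 + k 2 * p 1)]

/-- `symb Δ4 (k,p) = I₁`. [folklore] -/
theorem symb_Δ4 (k p : Fin 3 → ℝ) : Torus.symb Δ4 k p = I1 k p := by
  unfold Torus.symb Δ4 I1
  simp [Fin.sum_univ_three]
  ring

/-- `symb Sc (k,p) = |k|²|p|² + κc I₁`. [folklore] -/
theorem symb_Sc (k p : Fin 3 → ℝ) : Torus.symb Sc k p = Nkp k p + κc * I1 k p := by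
  rw [Sc, Torus.symb_add, Torus.symb_smul, Torus.symb_isoVisc, symb_Δ4]
  simp [Fin.sum_univ_three, Nkp]

/-- `sloC·|k|²|p|² ≤ symb Sc ≤ |k|²|p|²` on transverse pairs (`κc < 0`, `0 ≤ I₁ ≤ |k|²|p|²/2`). [folklore] -/
theorem symb_Sc_bounds {k p : Fin 3 → ℝ} (h : ∑ i, p i * k i = 0) :
    sloC * Nkp k p ≤ Torus.symb Sc k p ∧ Torus.symb Sc k p ≤ Nkp k p := by
  rw [symb_Sc, sloC_eq, Nkp_eq]
  have h1 := I1_nonneg k p; have h2 := I1_le_I2_of_perp h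
  have hκ : κc < 0 := by unfold κc; norm_num
  constructor <;> nlinarith

/-- `NearIso Sc sloC 1`. [folklore] -/
theorem nearIso_Sc : Torus.NearIso Sc sloC 1 := by
  intro k p h
  have hb := symb_Sc_bounds h
  have hN : (∑ a, k a ^ 2) * (∑ i, p i ^ 2) = Nkp k p := by simp [Fin.sum_univ_three, Nkp]
  rw [hN]; exact ⟨hb.1, by linarith [hb.2]⟩

/-- `Sc/λ₀ ≼ I ≼ λ₀ Sc`. [folklore] -/
theorem inInterval_Sc_iso : InInterval Sc lam0 (Torus.isoVisc 1) := by
  constructor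
  · intro k p h
    rw [Torus.symb_smul, Torus.symb_isoVisc]
    have hb := symb_Sc_bounds h
    have hN : (∑ a, k a ^ 2) * (∑ i, p i ^ 2) = Nkp k p := by simp [Fin.sum_univ_three, Nkp]
    rw [hN]
    have hN0 := Nkp_nonneg k p
    have : 1 / lam0 * Torus.symb Sc k p ≤ Torus.symb Sc k p := by
      rw [div_mul_eq_mul_div, one_mul, div_le_iff₀ lam0_pos]; unfold lam0; nlinarith [hb.1, hb.2, show (0:ℝ) < sloC by unfold sloC; norm_num]
    linarith [hb.2]
  · intro k p h
    rw [Torus.symb_smul, Torus.symb_isoVisc]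
    have hb := symb_Sc_bounds h
    have hN : (∑ a, k a ^ 2) * (∑ i, p i ^ 2) = Nkp k p := by simp [Fin.sum_univ_three, Nkp]
    rw [hN]
    have hN0 := Nkp_nonneg k p
    have hls : 1 ≤ lam0 * sloC := by unfold lam0 sloC; norm_num
    have h1 := mul_le_mul_of_nonneg_left hb.1 lam0_pos.le
    have h2 := mul_le_mul_of_nonneg_right hls hN0
    nlinarith [h1, h2]

/-! ## §2 Per-slot coordinate forms (integer slot data of `cubatureWord`) -/

/-- `M = |m|²`. -/
def Mq (d : SlotData) : ℝ := (d.m 0 : ℝ) ^ 2 + (d.m 1 : ℝ) ^ 2 + (d.m 2 : ℝ) ^ 2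
/-- `M·|P_m p|² = M|p|² − (m·p)²`. -/
def PpM (d : SlotData) (p : Fin 3 → ℝ) : ℝ :=
  Mq d * (p 0 ^ 2 + p 1 ^ 2 + p 2 ^ 2) - (p 0 * d.m 0 + p 1 * d.m 1 + p 2 * d.m 2) ^ 2
/-- `Z = Σ_c (m_{c+1} m_{c+2})² p_c²` (face diagonal: the square of the component of `p` along the coordinate axis `⊥ m`). -/
def Zf (d : SlotData) (p : Fin 3 → ℝ) : ℝ :=
  ((d.m 1 : ℝ) * d.m 2) ^ 2 * p 0 ^ 2 + ((d.m 2 : ℝ) * d.m 0) ^ 2 * p 1 ^ 2 + ((d.m 0 : ℝ) * d.m 1) ^ 2 * p 2 ^ 2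
/-- the reduced k-side slot coefficient `τ (v·k)²/(n M²)` (`= slotCoef·(e·k)²·2(2π)⁴·3720`, `slotCoef_mul_sq`). -/
def kCoef (d : SlotData) (k : Fin 3 → ℝ) : ℝ :=
  (d.τ : ℝ) * ((d.v 0 : ℝ) * k 0 + d.v 1 * k 1 + d.v 2 * k 2) ^ 2 / (d.n * Mq d ^ 2)
/-- Lagrange interpolation of the three class constants in `M ∈ {1,2,3}`. -/
def qLag (A1 A2 A3 x : ℝ) : ℝ := A1 * ((x - 2) * (x - 3) / 2) - A2 * ((x - 1) * (x - 3)) + A3 * ((x - 1) * (x - 2) / 2)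
/-- UPPER per-slot form (bounds `λ₀/λ · pᵀQ_s p`). -/
def uForm (d : SlotData) (p : Fin 3 → ℝ) : ℝ :=
  qLag qA1 qA2 qA3 (Mq d) * PpM d p + qB2 * ((Mq d - 1) * (3 - Mq d)) * Zf d p
/-- LOWER per-slot form (bounded by `λ · pᵀQ_s p`). -/
def lForm (d : SlotData) (p : Fin 3 → ℝ) : ℝ :=
  qLag lA1 lA2 lA3 (Mq d) * PpM d p + lB2 * ((Mq d - 1) * (3 - Mq d)) * Zf d p

/-- Pure algebra behind `slotCoef_mul_sq`. -/
theorem coef_algebra (τ r M sn n S c : ℝ) (hr : r ^ 2 = M) (hM : 0 < M) (hsn : sn ^ 2 = n) (hn : 0 < n) (hc : 0 < c) :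
    τ / (2 * (c * r) ^ 4) / 3720 * ((1 / sn) * S) ^ 2 = τ * S ^ 2 / (n * M ^ 2) / (2 * c ^ 4 * 3720) := by
  have hr0 : r ≠ 0 := by rintro rfl; simp at hr; linarith
  have hsn0 : sn ≠ 0 := by rintro rfl; simp at hsn; linarith
  have hr4 : r ^ 4 = M ^ 2 := by rw [← hr]; ring
  have e1 : (c * r) ^ 4 = c ^ 4 * M ^ 2 := by rw [mul_pow, hr4]
  have e2 : ((1 / sn) * S) ^ 2 = S ^ 2 / n := by rw [mul_pow, one_div, inv_pow, hsn]; ring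
  rw [e1, e2]
  field_simp

/-- The k-side coefficient of a slot of the cubature word in closed form:
`slotCoef_s · (e_s·k)² = τ_s (v_s·k)²/(n_s M_s²) / (2(2π)⁴·3720)`. [folklore] -/
theorem slotCoef_mul_sq (j : Fin 26) (k : Fin 3 → ℝ) :
    slotCoef cubatureWord j * (∑ a, (cubatureWord.phase j).e a * k a) ^ 2 = kCoef (slots j) k / (2 * (2 * π) ^ 4 * 3720) := by
  have h := slots_ok j
  have hn : (0 : ℝ) < (slots j).n := by exact_mod_cast h.2.1
  have hM2 : ‖Torus.latticeVec (slots j).m‖ ^ 2 = Mq (slots j) := by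
    rw [norm_sq_fin_three]; simp only [Torus.latticeVec_apply, Mq]
  have hMpos : 0 < Mq (slots j) := by
    unfold Mq
    rcases h.1 with h0 | h0 | h0
    · have : (0:ℝ) < ((slots j).m 0 : ℝ) ^ 2 := by
        have : ((slots j).m 0 : ℝ) ≠ 0 := by exact_mod_cast h0
        positivity
      nlinarith [sq_nonneg ((slots j).m 1 : ℝ), sq_nonneg ((slots j).m 2 : ℝ)]
    · have : (0:ℝ) < ((slots j).m 1 : ℝ) ^ 2 := by
        have : ((slots j).m 1 : ℝ) ≠ 0 := by exact_mod_cast h0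
        positivity
      nlinarith [sq_nonneg ((slots j).m 0 : ℝ), sq_nonneg ((slots j).m 2 : ℝ)]
    · have : (0:ℝ) < ((slots j).m 2 : ℝ) ^ 2 := by
        have : ((slots j).m 2 : ℝ) ≠ 0 := by exact_mod_cast h0
        positivity
      nlinarith [sq_nonneg ((slots j).m 0 : ℝ), sq_nonneg ((slots j).m 1 : ℝ)]
  have he : ∀ a, (cubatureWord.phase j).e a = (1 / Real.sqrt (slots j).n) * ((slots j).v a : ℝ) := by
    intro a
    show ((1 / Real.sqrt (slots j).n) • Torus.latticeVec (slots j).v) a = _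
    rw [PiLp.smul_apply, smul_eq_mul, Torus.latticeVec_apply]
  have hsum : ∑ a, (cubatureWord.phase j).e a * k a =
      (1 / Real.sqrt (slots j).n) * (((slots j).v 0 : ℝ) * k 0 + (slots j).v 1 * k 1 + (slots j).v 2 * k 2) := by
    simp only [Fin.sum_univ_three, he]; ring
  rw [hsum]
  unfold slotCoef kCoef
  rw [period_cubatureWord]
  show ((slots j).τ : ℝ) / (2 * (2 * π * ‖Torus.latticeVec (slots j).m‖) ^ 4) / 3720 * _ = _
  exact coef_algebra _ ‖Torus.latticeVec (slots j).m‖ (Mq (slots j)) (Real.sqrt (slots j).n) (slots j).n _ (2 * π) hM2 hMpos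
    (Real.sq_sqrt hn.le) hn (by positivity)

/-- THE 26-SLOT SUM AS AN INVARIANT FORM, for arbitrary class constants (frame completeness + cubature geometry, by `ring`). [folklore] -/
theorem slot_sum_poly (A1 A2 A3 B2 : ℝ) (k p : Fin 3 → ℝ) :
    ∑ j, kCoef (slots j) k * (qLag A1 A2 A3 (Mq (slots j)) * PpM (slots j) p + B2 * ((Mq (slots j) - 1) * (3 - Mq (slots j))) * Zf (slots j) p)
      = (80 * A1 + 192 * A2 + 144 * A3 + 64 * B2) * I1 k p + (40 * A1 + 160 * A2 + 144 * A3 + 32 * B2) * I2 k p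
        + (64 * A2 + 72 * A3) * I3 k p := by
  simp only [Fin.sum_univ_succ, Fin.sum_univ_zero, slots, kCoef, qLag, PpM, Zf, Mq, I1, I2, I3, Matrix.cons_val_zero, Matrix.cons_val_succ,
    Matrix.cons_val_one, Matrix.head_cons, Matrix.cons_val_two, Matrix.tail_cons]
  push_cast
  field_simp
  ring

theorem sum_kCoef_uForm (k p : Fin 3 → ℝ) : ∑ j, kCoef (slots j) k * uForm (slots j) p = u1 * I1 k p + u2 * I2 k p + u3 * I3 k p := by
  simp only [uForm, u1, u2, u3]; exact slot_sum_poly qA1 qA2 qA3 qB2 k p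

theorem sum_kCoef_lForm (k p : Fin 3 → ℝ) : ∑ j, kCoef (slots j) k * lForm (slots j) p = l1 * I1 k p + l2 * I2 k p + l3 * I3 k p := by
  simp only [lForm, l1, l2, l3]; exact slot_sum_poly lA1 lA2 lA3 lB2 k p


/-! ## §3 Per-slot bounds from the block level (v2: the former per-slot stubs are THEOREMS; the analytic leaves S2 / N110U,L / N100,N111 cite p681750 / `…Enclosures110` / p681593) -/

/-! ### §3.1 Major symmetrisation `½(S + Sᵀ)`: same transverse symbol, same order interval, no odd part; its block is `½(B̂ + B̂ᵀ)` -/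

/-- the major-symmetrised tensor `½(S + Sᵀ)` (`Sᵀ i a j b = S j b i a`). -/
def symS (S : T4) : T4 := (1 / 2 : ℝ) • (S + Torus.majorTranspose S)

theorem majorSymm_symS (S : T4) : Torus.MajorSymm (symS S) :=
  (Torus.majorSymm_add_majorTranspose S).smul _

theorem oddSmall_symS (S : T4) : Torus.OddSmall (symS S) 0 := (majorSymm_symS S).oddSmall 0

theorem symb_symS (S : T4) (k p : Fin 3 → ℝ) : Torus.symb (symS S) k p = Torus.symb S k p := by
  unfold symS; rw [Torus.symb_smul, Torus.symb_add, Torus.symb_majorTranspose]; ring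

theorem inInterval_symS {Sstar S : T4} {lam : ℝ} (h : InInterval Sstar lam S) : InInterval Sstar lam (symS S) :=
  ⟨fun k p hp => by rw [symb_symS]; exact h.1 k p hp, fun k p hp => by rw [symb_symS]; exact h.2 k p hp⟩

theorem sigMat_symS (S : T4) (n : Fin 3 → ℝ) (i j : Fin 3) :
    sigMat (symS S) n i j = (sigMat S n i j + sigMat S n j i) / 2 := by
  simp only [sigMat, symS, Pi.smul_apply, Pi.add_apply, smul_eq_mul, Torus.majorTranspose_apply, Fin.sum_univ_three]
  ring

/-- the block of the symmetrisation is the symmetrisation of the block. [folklore] -/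
theorem regBlock_symS (S : T4) (n : Fin 3 → ℝ) :
    regBlock (symS S) n = (1 / 2 : ℝ) • (regBlock S n + (regBlock S n).transpose) := by
  ext i j
  simp only [regBlock, Matrix.add_apply, Matrix.smul_apply, Matrix.transpose_apply, smul_eq_mul, Matrix.mul_apply,
    Matrix.vecMulVec_apply, sigMat_symS, Fin.sum_univ_three]
  have hP : ∀ a b : Fin 3, projPerp n a b = projPerp n b a := fun a b => projPerp_apply_comm n a b
  rw [hP 0 i, hP 1 i, hP 2 i, hP j 0, hP j 1, hP j 2]
  ring

/-! ### §3.2 The bilinear form of the block and the sectorial skew bound -/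

theorem projPerp_transpose (n : Fin 3 → ℝ) : (projPerp n).transpose = projPerp n := by
  ext i j; exact projPerp_apply_comm n j i

/-- `uᵀ B̂(S,n) w = β_S(n; P u, P w) + (n·u)(n·w)` for a unit `n` (any `S`). [folklore] -/
theorem regBlock_bilin (n : Fin 3 → ℝ) (S : T4) (u w : Fin 3 → ℝ) :
    ∑ i, ∑ j, u i * regBlock S n i j * w j
      = Torus.bsymb S n ((projPerp n).mulVec u) ((projPerp n).mulVec w) + (∑ i, n i * u i) * (∑ i, n i * w i) := by
  rw [← sum_sum_mul_sigMat_mul, ← sum_mul_mulVec_eq_sum_sum, ← sum_mul_mulVec_eq_sum_sum, regBlock, Matrix.add_mulVec,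
    ← Matrix.mulVec_mulVec, ← Matrix.mulVec_mulVec]
  have h1 : ∑ i, u i * ((projPerp n).mulVec ((sigMat S n).mulVec ((projPerp n).mulVec w)) + (Matrix.vecMulVec n n).mulVec w) i
      = u ⬝ᵥ (projPerp n).mulVec ((sigMat S n).mulVec ((projPerp n).mulVec w)) + u ⬝ᵥ (Matrix.vecMulVec n n).mulVec w := by
    simp only [Pi.add_apply, mul_add, Finset.sum_add_distrib, dotProduct]
  have hvm : Matrix.vecMul u (projPerp n) = (projPerp n).mulVec u := by rw [← Matrix.vecMul_transpose, projPerp_transpose]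
  rw [h1, Matrix.dotProduct_mulVec u (projPerp n), hvm]
  simp only [dotProduct, Matrix.mulVec, Matrix.vecMulVec_apply, Fin.sum_univ_three]
  ring

/-- **Sectorial skew bound for the block.**  `Sc/λ ≼ S ≼ λSc` and `OddSectorial S τ` give
`(uᵀB̂w − wᵀB̂u)² ≤ 4(τλ/2)²|u|²|w|²` at every unit `n` (`4ω² = τ²λ²`). [folklore] -/
theorem regBlock_skew {n : Fin 3 → ℝ} (hn : ∑ a, n a ^ 2 = 1) {S : T4} {τ lam : ℝ} (hτ : 0 ≤ τ) (hlam : 1 ≤ lam)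
    (hI : InInterval Sc lam S) (hO : OddSectorial S τ) (u w : Fin 3 → ℝ) :
    (∑ i, ∑ j, u i * regBlock S n i j * w j - ∑ i, ∑ j, w i * regBlock S n i j * u j) ^ 2
      ≤ 4 * (τ * lam / 2) ^ 2 * (∑ i, u i ^ 2) * (∑ i, w i ^ 2) := by
  rw [regBlock_bilin, regBlock_bilin]
  set u' := (projPerp n).mulVec u
  set w' := (projPerp n).mulVec w
  have hu' : ∑ i, u' i * n i = 0 := sum_projPerp_mulVec_mul hn u
  have hw' : ∑ i, w' i * n i = 0 := sum_projPerp_mulVec_mul hn w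
  have hodd := hO n u' w' hu' hw'
  have hn1 : ∑ a, n a ^ 2 = 1 := hn
  -- windows: 0 ≤ symb S n u' ≤ lam |u|²
  have hSu := (hI.2 n u' hu'); have hSw := (hI.2 n w' hw')
  have hSu0 := (hI.1 n u' hu'); have hSw0 := (hI.1 n w' hw')
  rw [Torus.symb_smul] at hSu hSw hSu0 hSw0
  have hcu := (nearIso_Sc n u' hu'); have hcw := (nearIso_Sc n w' hw')
  rw [hn1] at hcu hcw
  have hPu : ∑ i, u' i ^ 2 = ∑ i, u i ^ 2 - (∑ i, u i * n i) ^ 2 := sum_sq_projPerp_mulVec hn u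
  have hPw : ∑ i, w' i ^ 2 = ∑ i, w i ^ 2 - (∑ i, w i * n i) ^ 2 := sum_sq_projPerp_mulVec hn w
  have hslo : (0:ℝ) < sloC := by unfold sloC; norm_num
  have hl0 : 0 < lam := by linarith
  have hA0 : 0 ≤ Torus.symb S n u' := by
    have : 0 ≤ Torus.symb Sc n u' := by nlinarith [hcu.1, Nkp_nonneg n u', show 0 ≤ ∑ i, u' i ^ 2 by positivity]
    have h2 : 0 ≤ 1 / lam * Torus.symb Sc n u' := by positivity
    linarith
  have hB0 : 0 ≤ Torus.symb S n w' := by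
    have : 0 ≤ Torus.symb Sc n w' := by nlinarith [hcw.1, show 0 ≤ ∑ i, w' i ^ 2 by positivity]
    have h2 : 0 ≤ 1 / lam * Torus.symb Sc n w' := by positivity
    linarith
  have hAu : Torus.symb S n u' ≤ lam * ∑ i, u i ^ 2 := by
    have h1 : Torus.symb Sc n u' ≤ ∑ i, u i ^ 2 := by nlinarith [hcu.2, sq_nonneg (∑ i, u i * n i)]
    nlinarith
  have hBw : Torus.symb S n w' ≤ lam * ∑ i, w i ^ 2 := by
    have h1 : Torus.symb Sc n w' ≤ ∑ i, w i ^ 2 := by nlinarith [hcw.2, sq_nonneg (∑ i, w i * n i)]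
    nlinarith
  have hprod : Torus.symb S n u' * Torus.symb S n w' ≤ (lam * ∑ i, u i ^ 2) * (lam * ∑ i, w i ^ 2) :=
    mul_le_mul hAu hBw hB0 (by positivity)
  have hsq : (Torus.bsymb S n u' w' + (∑ i, n i * u i) * (∑ i, n i * w i) -
      (Torus.bsymb S n w' u' + (∑ i, n i * w i) * (∑ i, n i * u i))) ^ 2 = (Torus.bsymb S n u' w' - Torus.bsymb S n w' u') ^ 2 := by ring
  rw [hsq]
  calc (Torus.bsymb S n u' w' - Torus.bsymb S n w' u') ^ 2 ≤ τ ^ 2 * (Torus.symb S n u' * Torus.symb S n w') := hodd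
    _ ≤ τ ^ 2 * ((lam * ∑ i, u i ^ 2) * (lam * ∑ i, w i ^ 2)) := mul_le_mul_of_nonneg_left hprod (sq_nonneg τ)
    _ = 4 * (τ * lam / 2) ^ 2 * (∑ i, u i ^ 2) * (∑ i, w i ^ 2) := by ring

/-! ### §3.3 The analytic leaves (former stubs, now citations): S2 = `oddEven_qsResp` (p681750), {110} interval enclosures = `encl_N110U/L`, point enclosures = `WEvenCertN.stub_N1xx*` (p681593) -/

/-- **STUB S2 (odd–even comparison; prover ad-sawtooth-k1loc-p1 g12, `…CellLawVQSOddEven.lean`).**  For a real `3×3` matrix `B` with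
`b|w|² ≤ wᵀBw` (`b > 0`) and skew part `(uᵀBw − wᵀBu)² ≤ 4ω²|u|²|w|²`, the quasi-static responses of `B` and of its symmetric part differ by at most
`ω²/b³` in form sense: `|vᵀ f_T(B) v − vᵀ f_T(½(B+Bᵀ)) v| ≤ (ω²/b³)|v|²`.  Energy proof: `u = e^{−tB}v`, `ū = e^{−tBᵀ}v`, `z = e^{−tB_s}v`;
`|u−z|, |ū−z| ≤ ωt e^{−tb}|v|`, `|u+ū−2z| ≤ ω²t²e^{−tb}|v|`, so `|vᵀe^{−tB}v − vᵀe^{−tB_s}v| ≤ (ω²t²/2)e^{−tb}|v|²`; integrate against the slot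
weights (`0 ≤ a ≤ 1`) with `∫₀^∞ t²e^{−tb} = 2/b³`. -/
theorem stub_oddEven (B : Matrix (Fin 3) (Fin 3) ℝ) {b ω ρ T : ℝ} (hb : 0 < b)
    (hfloor : ∀ w : Fin 3 → ℝ, b * ∑ i, w i ^ 2 ≤ ∑ i, ∑ j, w i * B i j * w j)
    (hskew : ∀ u w : Fin 3 → ℝ, (∑ i, ∑ j, u i * B i j * w j - ∑ i, ∑ j, w i * B i j * u j) ^ 2
      ≤ 4 * ω ^ 2 * (∑ i, u i ^ 2) * (∑ i, w i ^ 2))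
    (hρ : 0 < ρ) (hρ2 : ρ ≤ 1 / 2) (hT : 0 ≤ T) (v : Fin 3 → ℝ) :
    |∑ i, ∑ j, v i * qsResp ρ T B i j * v j - ∑ i, ∑ j, v i * qsResp ρ T ((1 / 2 : ℝ) • (B + B.transpose)) i j * v j|
      ≤ ω ^ 2 / b ^ 3 * ∑ i, v i ^ 2 :=
  oddEven_qsResp B v hb hfloor hskew ρ hT

/-- slot relaxation numbers `T_c = 4π²|m_c|²·M_B·τ_c` of the three classes and the {111} centre eigenvalue `β₁₁₁ = 1 + κc/3`. -/
def T100 : ℝ := 4 * π ^ 2 * 1 * MB * 40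
def T110 : ℝ := 4 * π ^ 2 * 2 * MB * 128
def T111 : ℝ := 4 * π ^ 2 * 3 * MB * 243
def β111 : ℝ := 1 + κc / 3

/-- **STUB N100U** (`f₁₀₀(1/λ₀) ≤ U100'`; closed form `qsRespScalar_eq_closed_form` + exp enclosures; gap `1.0·10⁻⁷`). -/
theorem stub_N100U : qsRespScalar (1 / 2) T100 (1 / lam0) ≤ U100p := WEvenCertN.stub_N100U

/-- **STUB N100L** (`L100' ≤ λ₀ f₁₀₀(λ₀)`; gap `1.0·10⁻⁷`). -/
theorem stub_N100L : L100p ≤ lam0 * qsRespScalar (1 / 2) T100 (lam0 * 1) := WEvenCertN.stub_N100L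

/-- **STUB N111U** (`f₁₁₁(β₁₁₁/λ₀) ≤ U111'`; gap `1.0·10⁻⁷`). -/
theorem stub_N111U : qsRespScalar (1 / 2) T111 (β111 / lam0) ≤ U111p := WEvenCertN.stub_N111U

/-- **STUB N111L** (`L111' ≤ λ₀ f₁₁₁(λ₀β₁₁₁)`; gap `1.0·10⁻⁷`). -/
theorem stub_N111L : L111p ≤ lam0 * qsRespScalar (1 / 2) T111 (lam0 * β111) := WEvenCertN.stub_N111L

/-- **STUB N110U** (tangent majorant of the concave `u ↦ f₁₁₀(1/(λ₀u)) = λ₀u·ϑ(½, T₁₁₀/(λ₀u))` at `u₀ = ½(1 + 1/β_d)`; min gap `1.0·10⁻⁷` at `u₀`). -/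
theorem stub_N110U : ∀ u ∈ Set.Icc (83 / 100 : ℝ) (1002 / 1000), qsRespScalar (1 / 2) T110 (1 / (lam0 * u)) ≤ UAp + UB * u :=
  encl_N110U

/-- **STUB N110L** (tangent minorant of the convex `x ↦ λ₀ f₁₁₀(λ₀x)` at `x₀ = ½(1 + β_d)`; min gap `1.0·10⁻⁷` at `x₀`). -/
theorem stub_N110L : ∀ x ∈ Set.Icc (83 / 100 : ℝ) 1, LAp + LB * x ≤ lam0 * qsRespScalar (1 / 2) T110 (lam0 * x) :=
  encl_N110L


/-! ### §3.4 The per-eigenvalue step for a SYMMETRIC block (used for the {110} slots; eigenbasis from Mathlib's spectral theorem) -/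

/-- **UPPER per-eigenvalue step.**  `Bs` symmetric, `a|w|² ≤ wᵀBs w ≤ c|w|²` (`a > 0`), `(1/λ)R(w) ≤ wᵀBs w` for a reference form `R`,
`λ ≥ λ₀`; an affine majorant `f_T(1/(λ₀u)) ≤ A + B·u` (`B ≥ 0`) on the range of `u = 1/(λγ)`, `γ ∈ [a,c]` (ray reduction
`f(γ) ≤ (λ/λ₀) f(λγ/λ₀)`, `qsRespScalar_div_antitone_ray`); and the inverse-form majorant `B(2λ v·w − R(w)) ≤ λ²·B·Y` for all `w`.
Then `vᵀ f_T(Bs) v ≤ (λ/λ₀)(A|v|² + B·Y)` (Parseval + `Σ_k (q_k·v)²/γ_k = 2v·w⋆ − w⋆ᵀBs w⋆`). [folklore] -/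
theorem form_qsResp_le_of_eig {Bs : Matrix (Fin 3) (Fin 3) ℝ} (hBs : Bs.IsSymm) {lam a c T A B Y ulo uhi : ℝ}
    (R : (Fin 3 → ℝ) → ℝ) (v : Fin 3 → ℝ) (hlam : lam0 ≤ lam) (ha0 : 0 < a)
    (ha : ∀ w : Fin 3 → ℝ, a * ∑ i, w i ^ 2 ≤ ∑ i, ∑ j, w i * Bs i j * w j)
    (hc : ∀ w : Fin 3 → ℝ, ∑ i, ∑ j, w i * Bs i j * w j ≤ c * ∑ i, w i ^ 2)
    (hR : ∀ w : Fin 3 → ℝ, 1 / lam * R w ≤ ∑ i, ∑ j, w i * Bs i j * w j)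
    (hT : 0 < T) (hB : 0 ≤ B)
    (hu : ∀ γ, a ≤ γ → γ ≤ c → ulo ≤ 1 / (lam * γ) ∧ 1 / (lam * γ) ≤ uhi)
    (hN : ∀ u ∈ Set.Icc ulo uhi, qsRespScalar (1 / 2) T (1 / (lam0 * u)) ≤ A + B * u)
    (hY : ∀ w : Fin 3 → ℝ, B * (2 * lam * ∑ i, v i * w i - R w) ≤ lam ^ 2 * B * Y) :
    ∑ i, ∑ j, v i * qsResp (1 / 2) T Bs i j * v j ≤ lam / lam0 * (A * ∑ i, v i ^ 2 + B * Y) := by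
  have hH : Bs.IsHermitian := isHermitian_of_isSymm hBs
  set e := hH.eigenvectorBasis with he
  set γ := hH.eigenvalues with hγ
  have heq : ∀ k, Bs.mulVec (e k) = γ k • ⇑(e k) := fun k => hH.mulVec_eigenvectorBasis k
  have hγa : ∀ k, a ≤ γ k := fun k => le_eig_of_loewner_floor e γ heq ha k
  have hγpos : ∀ k, 0 < γ k := fun k => lt_of_lt_of_le ha0 (hγa k)
  have hγc : ∀ k, γ k ≤ c := fun k => eig_le_of_loewner_ceiling e γ heq hc k
  have hl0 : 0 < lam := lt_of_lt_of_le lam0_pos hlam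
  rw [sum_sum_mul_qsResp_mul_self_eq_sum_eig hBs e γ heq]
  have hpars : ∑ i, v i ^ 2 = ∑ k, (∑ i, e k i * v i) ^ 2 := by
    have h := sum_mul_eq_sum_eig e v v
    simpa only [sq] using h
  have hdir : ∀ k, qsRespScalar (1 / 2) T (γ k) ≤ lam / lam0 * (A + B * (1 / (lam * γ k))) := by
    intro k
    have hray := qsRespScalar_div_antitone_ray (ρ := 1 / 2) (T := T) (β := lam * γ k) (by norm_num) (by norm_num) hT
      (mul_pos hl0 (hγpos k)) lam0_pos hlam
    have e1 : lam * γ k / lam = γ k := by field_simp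
    rw [e1] at hray
    have huk := hu (γ k) (hγa k) (hγc k)
    have hNk := hN (1 / (lam * γ k)) ⟨huk.1, huk.2⟩
    have e2 : 1 / (lam0 * (1 / (lam * γ k))) = lam * γ k / lam0 := by
      have := (hγpos k).ne'; have := hl0.ne'; have := lam0_pos.ne'; field_simp
    rw [e2] at hNk
    have h3 : qsRespScalar (1 / 2) T (γ k) ≤ lam * (qsRespScalar (1 / 2) T (lam * γ k / lam0) / lam0) := by
      rw [div_le_iff₀ hl0] at hray; linarith [hray]
    calc qsRespScalar (1 / 2) T (γ k) ≤ lam * (qsRespScalar (1 / 2) T (lam * γ k / lam0) / lam0) := h3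
      _ ≤ lam * ((A + B * (1 / (lam * γ k))) / lam0) :=
          mul_le_mul_of_nonneg_left (div_le_div_of_nonneg_right hNk lam0_pos.le) hl0.le
      _ = lam / lam0 * (A + B * (1 / (lam * γ k))) := by ring
  have hsum : ∑ k, qsRespScalar (1 / 2) T (γ k) * (∑ i, e k i * v i) ^ 2
      ≤ ∑ k, lam / lam0 * (A + B * (1 / (lam * γ k))) * (∑ i, e k i * v i) ^ 2 :=
    Finset.sum_le_sum fun k _ => mul_le_mul_of_nonneg_right (hdir k) (sq_nonneg _)
  have hsplit : ∑ k, lam / lam0 * (A + B * (1 / (lam * γ k))) * (∑ i, e k i * v i) ^ 2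
      = lam / lam0 * (A * ∑ k, (∑ i, e k i * v i) ^ 2 + B / lam * ∑ k, (∑ i, e k i * v i) ^ 2 / γ k) := by
    rw [Finset.mul_sum, Finset.mul_sum, ← Finset.sum_add_distrib, Finset.mul_sum]
    refine Finset.sum_congr rfl fun k _ => ?_
    have := (hγpos k).ne'; have := hl0.ne'
    field_simp
  set ws : Fin 3 → ℝ := fun i => ∑ k, ((∑ j, e k j * v j) / γ k) * e k i with hws
  have hinv : ∑ k, (∑ i, e k i * v i) ^ 2 / γ k = 2 * ∑ i, v i * ws i - ∑ i, ∑ j, ws i * Bs i j * ws j :=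
    (two_mul_sub_quad_eq_inv_form hBs e γ heq v).symm
  have hinv_le : B / lam * ∑ k, (∑ i, e k i * v i) ^ 2 / γ k ≤ B * Y := by
    rw [hinv]
    have h1 := hR ws
    have h2 := hY ws
    have hBl : 0 ≤ B / lam := div_nonneg hB hl0.le
    have h3 : B / lam * (2 * ∑ i, v i * ws i - ∑ i, ∑ j, ws i * Bs i j * ws j)
        ≤ B / lam * (2 * ∑ i, v i * ws i - 1 / lam * R ws) :=
      mul_le_mul_of_nonneg_left (by linarith) hBl
    have h4 : B / lam * (2 * ∑ i, v i * ws i - 1 / lam * R ws) = (B * (2 * lam * ∑ i, v i * ws i - R ws)) / lam ^ 2 := by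
      field_simp
    have h5 : (B * (2 * lam * ∑ i, v i * ws i - R ws)) / lam ^ 2 ≤ lam ^ 2 * B * Y / lam ^ 2 :=
      div_le_div_of_nonneg_right h2 (by positivity)
    have h6 : lam ^ 2 * B * Y / lam ^ 2 = B * Y := by field_simp
    linarith [h3, h4.le, h4.ge, h5, h6.le, h6.ge]
  calc ∑ k, qsRespScalar (1 / 2) T (γ k) * (∑ i, e k i * v i) ^ 2
      ≤ lam / lam0 * (A * ∑ k, (∑ i, e k i * v i) ^ 2 + B / lam * ∑ k, (∑ i, e k i * v i) ^ 2 / γ k) := by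
        rw [← hsplit]; exact hsum
    _ ≤ lam / lam0 * (A * ∑ i, v i ^ 2 + B * Y) := by
        rw [← hpars]
        exact mul_le_mul_of_nonneg_left (by linarith [hinv_le]) (div_nonneg hl0.le lam0_pos.le)

/-- **LOWER per-eigenvalue step.**  `Bs` symmetric, `a|w|² ≤ wᵀBs w ≤ c|w|²` (`a > 0`), `vᵀBs v ≤ λ R(v)`, `λ ≥ λ₀`; an affine minorant
`A' + B'x ≤ λ₀ f_T(λ₀ x)` (`B' ≤ 0`) on the range of `x = γ/λ`, `γ ∈ [a,c]` (ray reduction `λ f(γ) ≥ λ₀ f(λ₀γ/λ)`,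
`mul_qsRespScalar_mul_mono_ray`).  Then `(1/λ)(A'|v|² + B'·R(v)) ≤ vᵀ f_T(Bs) v` (Parseval + `Σ_k γ_k (q_k·v)² = vᵀBs v`). [folklore] -/
theorem le_form_qsResp_of_eig {Bs : Matrix (Fin 3) (Fin 3) ℝ} (hBs : Bs.IsSymm) {lam a c T A' B' xlo xhi : ℝ}
    (R : (Fin 3 → ℝ) → ℝ) (v : Fin 3 → ℝ) (hlam : lam0 ≤ lam) (ha0 : 0 < a)
    (ha : ∀ w : Fin 3 → ℝ, a * ∑ i, w i ^ 2 ≤ ∑ i, ∑ j, w i * Bs i j * w j)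
    (hc : ∀ w : Fin 3 → ℝ, ∑ i, ∑ j, w i * Bs i j * w j ≤ c * ∑ i, w i ^ 2)
    (hRv : ∑ i, ∑ j, v i * Bs i j * v j ≤ lam * R v)
    (hT : 0 < T) (hB' : B' ≤ 0)
    (hx : ∀ γ, a ≤ γ → γ ≤ c → xlo ≤ γ / lam ∧ γ / lam ≤ xhi)
    (hN : ∀ x ∈ Set.Icc xlo xhi, A' + B' * x ≤ lam0 * qsRespScalar (1 / 2) T (lam0 * x)) :
    1 / lam * (A' * ∑ i, v i ^ 2 + B' * R v) ≤ ∑ i, ∑ j, v i * qsResp (1 / 2) T Bs i j * v j := by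
  have hH : Bs.IsHermitian := isHermitian_of_isSymm hBs
  set e := hH.eigenvectorBasis with he
  set γ := hH.eigenvalues with hγ
  have heq : ∀ k, Bs.mulVec (e k) = γ k • ⇑(e k) := fun k => hH.mulVec_eigenvectorBasis k
  have hγa : ∀ k, a ≤ γ k := fun k => le_eig_of_loewner_floor e γ heq ha k
  have hγpos : ∀ k, 0 < γ k := fun k => lt_of_lt_of_le ha0 (hγa k)
  have hγc : ∀ k, γ k ≤ c := fun k => eig_le_of_loewner_ceiling e γ heq hc k
  have hl0 : 0 < lam := lt_of_lt_of_le lam0_pos hlam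
  have hBv : ∑ i, ∑ j, v i * Bs i j * v j = ∑ k, γ k * (∑ i, e k i * v i) ^ 2 := by
    rw [sum_sum_mul_mul_eq_sum_eig hBs e γ heq v v]
    exact Finset.sum_congr rfl fun k _ => by rw [sq]
  rw [sum_sum_mul_qsResp_mul_self_eq_sum_eig hBs e γ heq]
  have hpars : ∑ i, v i ^ 2 = ∑ k, (∑ i, e k i * v i) ^ 2 := by
    have h := sum_mul_eq_sum_eig e v v
    simpa only [sq] using h
  have hdir : ∀ k, 1 / lam * (A' + B' * (γ k / lam)) ≤ qsRespScalar (1 / 2) T (γ k) := by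
    intro k
    have hray := mul_qsRespScalar_mul_mono_ray (ρ := 1 / 2) (T := T) (β := γ k / lam) (by norm_num) (by norm_num) hT
      (div_pos (hγpos k) hl0) lam0_pos hlam
    have e1 : lam * (γ k / lam) = γ k := by field_simp
    rw [e1] at hray
    have hxk := hx (γ k) (hγa k) (hγc k)
    have hNk := hN (γ k / lam) ⟨hxk.1, hxk.2⟩
    have h3 : A' + B' * (γ k / lam) ≤ lam * qsRespScalar (1 / 2) T (γ k) := le_trans hNk hray
    rw [one_div, ← div_eq_inv_mul]
    exact (div_le_iff₀ hl0).2 (by linarith [h3])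
  have hsum : ∑ k, 1 / lam * (A' + B' * (γ k / lam)) * (∑ i, e k i * v i) ^ 2
      ≤ ∑ k, qsRespScalar (1 / 2) T (γ k) * (∑ i, e k i * v i) ^ 2 :=
    Finset.sum_le_sum fun k _ => mul_le_mul_of_nonneg_right (hdir k) (sq_nonneg _)
  have hsplit : ∑ k, 1 / lam * (A' + B' * (γ k / lam)) * (∑ i, e k i * v i) ^ 2
      = 1 / lam * (A' * ∑ k, (∑ i, e k i * v i) ^ 2 + B' / lam * ∑ k, γ k * (∑ i, e k i * v i) ^ 2) := by
    rw [Finset.mul_sum, Finset.mul_sum, ← Finset.sum_add_distrib, Finset.mul_sum]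
    refine Finset.sum_congr rfl fun k _ => ?_
    have := hl0.ne'
    field_simp
  have hlow : B' * R v ≤ B' / lam * ∑ k, γ k * (∑ i, e k i * v i) ^ 2 := by
    rw [← hBv]
    have hBl : B' / lam ≤ 0 := div_nonpos_of_nonpos_of_nonneg hB' hl0.le
    have h1 : B' / lam * (lam * R v) ≤ B' / lam * ∑ i, ∑ j, v i * Bs i j * v j := mul_le_mul_of_nonpos_left hRv hBl
    have h2 : B' / lam * (lam * R v) = B' * R v := by field_simp
    linarith [h1, h2.le, h2.ge]
  calc 1 / lam * (A' * ∑ i, v i ^ 2 + B' * R v)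
      ≤ 1 / lam * (A' * ∑ k, (∑ i, e k i * v i) ^ 2 + B' / lam * ∑ k, γ k * (∑ i, e k i * v i) ^ 2) := by
        rw [← hpars]
        exact mul_le_mul_of_nonneg_left (by linarith [hlow]) (by positivity)
    _ = ∑ k, 1 / lam * (A' + B' * (γ k / lam)) * (∑ i, e k i * v i) ^ 2 := hsplit.symm
    _ ≤ _ := hsum

/-! ### §3.5 Slot geometry of the cubature word: unit wave vector, relaxation number, coordinates -/

/-- the unit wave vector of slot `j`. -/
def nj (j : Fin 26) : Fin 3 → ℝ := mhat (cubatureWord.phase j)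
/-- the relaxation number `T_j = 4π²|m_j|² M_B τ_j` of slot `j`. -/
def Tj (j : Fin 26) : ℝ := 4 * π ^ 2 * Mq (slots j) * MB * (slots j).τ
/-- `m·w`, `|w|²`, `Σ_c m_c² w_c²`. -/
def mdot (d : SlotData) (w : Fin 3 → ℝ) : ℝ := (d.m 0 : ℝ) * w 0 + d.m 1 * w 1 + d.m 2 * w 2
def nsq (w : Fin 3 → ℝ) : ℝ := w 0 ^ 2 + w 1 ^ 2 + w 2 ^ 2
def I1m (d : SlotData) (w : Fin 3 → ℝ) : ℝ := (d.m 0 : ℝ) ^ 2 * w 0 ^ 2 + (d.m 1 : ℝ) ^ 2 * w 1 ^ 2 + (d.m 2 : ℝ) ^ 2 * w 2 ^ 2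

theorem norm_sq_m (j : Fin 26) : ‖Torus.latticeVec (slots j).m‖ ^ 2 = Mq (slots j) := by
  rw [norm_sq_fin_three]; simp only [Torus.latticeVec_apply, Mq]

theorem Mq_cases (j : Fin 26) : Mq (slots j) = 1 ∨ Mq (slots j) = 2 ∨ Mq (slots j) = 3 := by
  fin_cases j <;> simp [slots, Mq, Matrix.cons_val_zero, Matrix.cons_val_one, Matrix.cons_val_two, Matrix.head_cons, Matrix.tail_cons] <;> norm_num

theorem Mq_pos (j : Fin 26) : 0 < Mq (slots j) := by
  rcases Mq_cases j with h | h | h <;> rw [h] <;> norm_num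

theorem norm_m_pos (j : Fin 26) : 0 < ‖Torus.latticeVec (slots j).m‖ := by
  have h1 := norm_sq_m j; have h2 := Mq_pos j
  have h3 := norm_nonneg (Torus.latticeVec (slots j).m)
  by_contra h
  have : ‖Torus.latticeVec (slots j).m‖ = 0 := le_antisymm (not_lt.1 h) h3
  rw [this] at h1; norm_num at h1; linarith

theorem nj_apply (j : Fin 26) (a : Fin 3) : nj j a = ((slots j).m a : ℝ) / ‖Torus.latticeVec (slots j).m‖ := by
  show (Torus.latticeVec (slots j).m) a / ‖Torus.latticeVec (slots j).m‖ = _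
  rw [Torus.latticeVec_apply]

theorem nj_mul (j : Fin 26) (a b : Fin 3) : nj j a * nj j b = ((slots j).m a : ℝ) * (slots j).m b / Mq (slots j) := by
  rw [nj_apply, nj_apply, div_mul_div_comm, ← sq, norm_sq_m]

theorem hn_j (j : Fin 26) : ∑ a, nj j a ^ 2 = 1 := sum_mhat_sq _

theorem dot_nj (j : Fin 26) (w : Fin 3 → ℝ) : ∑ i, nj j i * w i = mdot (slots j) w / ‖Torus.latticeVec (slots j).m‖ := by
  simp only [Fin.sum_univ_three, nj_apply, mdot]; ring

theorem dot_nj' (j : Fin 26) (w : Fin 3 → ℝ) : ∑ i, w i * nj j i = mdot (slots j) w / ‖Torus.latticeVec (slots j).m‖ := by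
  rw [← dot_nj]; exact Finset.sum_congr rfl fun i _ => mul_comm _ _

theorem dot_nj_sq (j : Fin 26) (w : Fin 3 → ℝ) : (∑ i, w i * nj j i) ^ 2 = mdot (slots j) w ^ 2 / Mq (slots j) := by
  rw [dot_nj', div_pow, norm_sq_m]

theorem perp_iff (j : Fin 26) (w : Fin 3 → ℝ) : ∑ i, nj j i * w i = 0 ↔ mdot (slots j) w = 0 := by
  rw [dot_nj, div_eq_zero_iff]; exact or_iff_left (norm_m_pos j).ne'

theorem nsq_eq (w : Fin 3 → ℝ) : ∑ i, w i ^ 2 = nsq w := by simp [Fin.sum_univ_three, nsq]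

/-- `|P_j p|² = PpM/M`. -/
theorem perp_sq (j : Fin 26) (p : Fin 3 → ℝ) : ∑ i, p i ^ 2 - (∑ i, p i * nj j i) ^ 2 = PpM (slots j) p / Mq (slots j) := by
  rw [dot_nj_sq, nsq_eq]; unfold PpM nsq mdot
  have := (Mq_pos j).ne'
  field_simp

theorem projPerp_nj_apply (j : Fin 26) (w : Fin 3 → ℝ) (c : Fin 3) :
    (projPerp (nj j)).mulVec w c = w c - ((slots j).m c : ℝ) * mdot (slots j) w / Mq (slots j) := by
  rw [projPerp_mulVec, dot_nj, nj_apply, div_mul_div_comm, ← sq, norm_sq_m, mul_div_assoc]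

/-- `symb Sc (n_j, w) = |w|² + (κc/M) Σ_c m_c² w_c²` (`|n_j| = 1`). -/
theorem symb_Sc_nj (j : Fin 26) (w : Fin 3 → ℝ) : Torus.symb Sc (nj j) w = nsq w + κc / Mq (slots j) * I1m (slots j) w := by
  rw [symb_Sc]
  have e : ∀ c, nj j c ^ 2 = ((slots j).m c : ℝ) ^ 2 / Mq (slots j) := fun c => by rw [sq, nj_mul, sq]
  have h1 : Nkp (nj j) w = nsq w := by
    have h := hn_j j
    simp only [Fin.sum_univ_three] at h
    unfold Nkp nsq; rw [h, one_mul]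
  rw [h1]; unfold I1 I1m; rw [e 0, e 1, e 2]
  have := (Mq_pos j).ne'
  field_simp

/-- the slot response matrix in the `(T_j, n_j)` vocabulary (ramp `½`). -/
theorem slotQ_eq (S : T4) (j : Fin 26) : slotQ cubatureWord MB S j = qsResp (1 / 2) (Tj j) (regBlock S (nj j)) * projPerp (nj j) := by
  show qsResp (1 / 2) (4 * Real.pi ^ 2 * ‖Torus.latticeVec (slots j).m‖ ^ 2 * MB * ((slots j).τ : ℝ)) (regBlock S (nj j)) * projPerp (nj j) = _
  rw [norm_sq_m]; rfl

theorem Tj_pos (j : Fin 26) : 0 < Tj j := by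
  have h := (slots_ok j).2.2.2.2
  have hτ : (0:ℝ) < (slots j).τ := by exact_mod_cast h
  have := Mq_pos j
  unfold Tj MB; positivity

/-- the sectorial charge: `ω²/b³ = (τλ/2)²/(slo/λ)³ ≤ τ₀²Λ_w⁵/(4 slo³) ≤ ℓ̄`. -/
theorem oddCharge_le {lam τ : ℝ} (hlam : lam ∈ Icc lam0 LamW) (hτ : τ ∈ Icc 0 τ0c) :
    (τ * lam / 2) ^ 2 / (sloC / lam) ^ 3 ≤ ellBar := by
  have hl0 : 0 < lam := lt_of_lt_of_le lam0_pos hlam.1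
  have hslo : (0:ℝ) < sloC := by unfold sloC; norm_num
  have h1 : (τ * lam / 2) ^ 2 / (sloC / lam) ^ 3 = τ ^ 2 * lam ^ 5 / (4 * sloC ^ 3) := by
    field_simp; ring
  have h2 : τ ^ 2 ≤ τ0c ^ 2 := pow_le_pow_left₀ hτ.1 hτ.2 2
  have h3 : lam ^ 5 ≤ LamW ^ 5 := pow_le_pow_left₀ hl0.le hlam.2 5
  have h4 : τ ^ 2 * lam ^ 5 ≤ τ0c ^ 2 * LamW ^ 5 := mul_le_mul h2 h3 (by positivity) (by positivity)
  rw [h1]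
  calc τ ^ 2 * lam ^ 5 / (4 * sloC ^ 3) ≤ τ0c ^ 2 * LamW ^ 5 / (4 * sloC ^ 3) := div_le_div_of_nonneg_right h4 (by positivity)
    _ ≤ ellBar := by unfold τ0c LamW sloC ellBar; norm_num

/-- S2 at a slot: `|pᵀQ_j(S)p − pᵀQ_j(½(S+Sᵀ))p| ≤ ℓ̄ |P_j p|²`. -/
theorem slot_oddEven {lam τ : ℝ} (hlam : lam ∈ Icc lam0 LamW) (hτ : τ ∈ Icc 0 τ0c) {S : T4}
    (hI : InInterval Sc lam S) (hO : OddSectorial S τ) (j : Fin 26) (p : Fin 3 → ℝ) :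
    |∑ i, ∑ i', p i * slotQ cubatureWord MB S j i i' * p i' - ∑ i, ∑ i', p i * slotQ cubatureWord MB (symS S) j i i' * p i'|
      ≤ ellBar * (∑ i, p i ^ 2 - (∑ i, p i * nj j i) ^ 2) := by
  have hn := hn_j j
  have hl1 : 1 ≤ lam := le_trans (by unfold lam0; norm_num) hlam.1
  have hl0 : 0 < lam := by linarith
  have hslo : (0:ℝ) < sloC := by unfold sloC; norm_num
  rw [slotQ_eq, slotQ_eq, sum_sum_mul_qsResp_regBlock_projPerp hn, sum_sum_mul_qsResp_regBlock_projPerp hn, regBlock_symS,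
    ← sum_sq_projPerp_mulVec hn]
  set v := (projPerp (nj j)).mulVec p
  have hfloor : ∀ w : Fin 3 → ℝ, sloC / lam * ∑ i, w i ^ 2 ≤ ∑ i, ∑ j', w i * regBlock S (nj j) i j' * w j' :=
    fun w => regBlock_floor_of_inInterval hn hl1 (by rw [div_le_one hl0]; exact le_trans (by unfold sloC; norm_num) hl1)
      (fun w hw => by
        have h := (nearIso_Sc (nj j) w (by rw [← hw]; exact Finset.sum_congr rfl fun i _ => mul_comm _ _)).1
        rw [hn, one_mul] at h; exact h) hI w
  have hskew := regBlock_skew hn hτ.1 hl1 hI hO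
  have h := stub_oddEven (ρ := 1 / 2) (T := Tj j) (b := sloC / lam) (ω := τ * lam / 2) (regBlock S (nj j)) (div_pos hslo hl0) hfloor hskew
    (by norm_num) (by norm_num) (Tj_pos j).le v
  exact h.trans (mul_le_mul_of_nonneg_right (oddCharge_le hlam hτ) (by positivity))

/-! ### §3.6 Scalar classes {100}, {111}: block window `α = β` exact, pinch + ray reduction + point enclosure -/

/-- UPPER, scalar class: `pᵀQ_j(S)p ≤ (λ/λ₀)(U' + ℓ̄)|P_j p|²` when `symb Sc (n_j,·) = α|·|²` on `n_j^⊥` and `f_{T_j}(α/λ₀) ≤ U'`. -/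
theorem slot_upper_scalar {lam τ : ℝ} (hlam : lam ∈ Icc lam0 LamW) (hτ : τ ∈ Icc 0 τ0c) {S : T4}
    (hI : InInterval Sc lam S) (hO : OddSectorial S τ) (j : Fin 26) {α Up : ℝ}
    (hα0 : 0 < α) (hα1 : α ≤ 1)
    (hwin : ∀ w : Fin 3 → ℝ, ∑ i, nj j i * w i = 0 → Torus.symb Sc (nj j) w = α * ∑ i, w i ^ 2)
    (hNU : qsRespScalar (1 / 2) (Tj j) (α / lam0) ≤ Up) (p : Fin 3 → ℝ) :
    ∑ i, ∑ i', p i * slotQ cubatureWord MB S j i i' * p i'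
      ≤ lam / lam0 * ((Up + ellBar) * (∑ i, p i ^ 2 - (∑ i, p i * nj j i) ^ 2)) := by
  have hn := hn_j j
  have hl1 : 1 ≤ lam := le_trans (by unfold lam0; norm_num) hlam.1
  have hl0 : 0 < lam := by linarith
  have hodd := (abs_sub_le_iff.1 (slot_oddEven hlam hτ hI hO j p)).1
  have hP0 : 0 ≤ ∑ i, p i ^ 2 - (∑ i, p i * nj j i) ^ 2 := by rw [← sum_sq_projPerp_mulVec hn]; positivity
  -- symmetric part: pinch at the floor α/λ
  have hsym : ∑ i, ∑ i', p i * slotQ cubatureWord MB (symS S) j i i' * p i'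
      ≤ qsRespScalar (1 / 2) (Tj j) (α / lam) * (∑ i, p i ^ 2 - (∑ i, p i * nj j i) ^ 2) := by
    rw [slotQ_eq]
    exact slotForm_le_of_inInterval (oddSmall_symS S) hn hl1 (by rw [div_le_one hl0]; linarith)
      (fun w hw => (hwin w hw).ge) (inInterval_symS hI) (Tj_pos j).le p
  -- ray: f(α/λ) ≤ (λ/λ₀) f(α/λ₀) ≤ (λ/λ₀) U'
  have hray := qsRespScalar_div_antitone_ray (ρ := 1 / 2) (T := Tj j) (β := α) (by norm_num) (by norm_num) (Tj_pos j) hα0 lam0_pos hlam.1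
  have hf : qsRespScalar (1 / 2) (Tj j) (α / lam) ≤ lam / lam0 * Up := by
    rw [div_le_iff₀ hl0] at hray
    calc qsRespScalar (1 / 2) (Tj j) (α / lam) ≤ qsRespScalar (1 / 2) (Tj j) (α / lam0) / lam0 * lam := hray
      _ ≤ Up / lam0 * lam := mul_le_mul_of_nonneg_right (div_le_div_of_nonneg_right hNU lam0_pos.le) hl0.le
      _ = lam / lam0 * Up := by ring
  have hll : 1 ≤ lam / lam0 := by rw [le_div_iff₀ lam0_pos, one_mul]; exact hlam.1
  have h1 : qsRespScalar (1 / 2) (Tj j) (α / lam) * (∑ i, p i ^ 2 - (∑ i, p i * nj j i) ^ 2)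
      ≤ lam / lam0 * Up * (∑ i, p i ^ 2 - (∑ i, p i * nj j i) ^ 2) := mul_le_mul_of_nonneg_right hf hP0
  have h2 : ellBar * (∑ i, p i ^ 2 - (∑ i, p i * nj j i) ^ 2) ≤ lam / lam0 * ellBar * (∑ i, p i ^ 2 - (∑ i, p i * nj j i) ^ 2) := by
    apply mul_le_mul_of_nonneg_right _ hP0
    have : (0:ℝ) ≤ ellBar := by unfold ellBar; norm_num
    nlinarith
  nlinarith [hodd, hsym, h1, h2]

/-- LOWER, scalar class: `(1/λ)(L' − Λ_w ℓ̄)|P_j p|² ≤ pᵀQ_j(S)p` when `symb Sc (n_j,·) = α|·|²` on `n_j^⊥`, `1 ≤ λ₀α`, `L' ≤ λ₀ f_{T_j}(λ₀α)`. -/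
theorem slot_lower_scalar {lam τ : ℝ} (hlam : lam ∈ Icc lam0 LamW) (hτ : τ ∈ Icc 0 τ0c) {S : T4}
    (hI : InInterval Sc lam S) (hO : OddSectorial S τ) (j : Fin 26) {α Lp : ℝ}
    (hα0 : 0 < α) (hlamα : 1 ≤ lam0 * α)
    (hwin : ∀ w : Fin 3 → ℝ, ∑ i, nj j i * w i = 0 → Torus.symb Sc (nj j) w = α * ∑ i, w i ^ 2)
    (hNL : Lp ≤ lam0 * qsRespScalar (1 / 2) (Tj j) (lam0 * α)) (p : Fin 3 → ℝ) :
    1 / lam * ((Lp - LamW * ellBar) * (∑ i, p i ^ 2 - (∑ i, p i * nj j i) ^ 2))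
      ≤ ∑ i, ∑ i', p i * slotQ cubatureWord MB S j i i' * p i' := by
  have hn := hn_j j
  have hl1 : 1 ≤ lam := le_trans (by unfold lam0; norm_num) hlam.1
  have hl0 : 0 < lam := by linarith
  have hodd := (abs_sub_le_iff.1 (slot_oddEven hlam hτ hI hO j p)).2
  have hP0 : 0 ≤ ∑ i, p i ^ 2 - (∑ i, p i * nj j i) ^ 2 := by rw [← sum_sq_projPerp_mulVec hn]; positivity
  have hsym : qsRespScalar (1 / 2) (Tj j) (lam * α) * (∑ i, p i ^ 2 - (∑ i, p i * nj j i) ^ 2)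
      ≤ ∑ i, ∑ i', p i * slotQ cubatureWord MB (symS S) j i i' * p i' := by
    rw [slotQ_eq]
    exact slotForm_ge_of_inInterval (oddSmall_symS S) hn hl1 (le_trans hlamα (mul_le_mul_of_nonneg_right hlam.1 hα0.le))
      (fun w hw => (hwin w hw).le) (inInterval_symS hI) (Tj_pos j).le p
  have hray := mul_qsRespScalar_mul_mono_ray (ρ := 1 / 2) (T := Tj j) (β := α) (by norm_num) (by norm_num) (Tj_pos j) hα0 lam0_pos hlam.1
  -- λ₀ f(λ₀α) ≤ λ f(λα) ⇒ (1/λ) L' ≤ f(λα)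
  have hf : 1 / lam * Lp ≤ qsRespScalar (1 / 2) (Tj j) (lam * α) := by
    rw [one_div, ← div_eq_inv_mul, div_le_iff₀ hl0]; linarith
  have hE : (0:ℝ) ≤ ellBar := by unfold ellBar; norm_num
  have h1 : 1 / lam * Lp * (∑ i, p i ^ 2 - (∑ i, p i * nj j i) ^ 2)
      ≤ qsRespScalar (1 / 2) (Tj j) (lam * α) * (∑ i, p i ^ 2 - (∑ i, p i * nj j i) ^ 2) := mul_le_mul_of_nonneg_right hf hP0
  have h2 : ellBar * (∑ i, p i ^ 2 - (∑ i, p i * nj j i) ^ 2) ≤ 1 / lam * (LamW * ellBar) * (∑ i, p i ^ 2 - (∑ i, p i * nj j i) ^ 2) := by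
    apply mul_le_mul_of_nonneg_right _ hP0
    rw [one_div, ← div_eq_inv_mul, le_div_iff₀ hl0]
    nlinarith [hlam.2]
  nlinarith [hodd, hsym, h1, h2]


/-! ### §3.7 Face-diagonal class {110}: per-eigenvalue step with the explicit frame `z` (axis ⊥ m), `dv = z × m` -/

/-- frame data of a slot: `z_c = 1 − m_c²` (the coordinate axis `⊥ m` for a face diagonal), `dv = z × m`. -/
def zv (d : SlotData) : Fin 3 → ℝ := fun c => 1 - (d.m c : ℝ) ^ 2
def zd (d : SlotData) (w : Fin 3 → ℝ) : ℝ := zv d 0 * w 0 + zv d 1 * w 1 + zv d 2 * w 2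
def dd (d : SlotData) (w : Fin 3 → ℝ) : ℝ :=
  (zv d 1 * d.m 2 - zv d 2 * d.m 1) * w 0 + (zv d 2 * d.m 0 - zv d 0 * d.m 2) * w 1 + (zv d 0 * d.m 1 - zv d 1 * d.m 0) * w 2

theorem sI (c : ℝ) (M : Matrix (Fin 3) (Fin 3) ℝ) (w : Fin 3 → ℝ) :
    ∑ i, ∑ j, w i * (c • M) i j * w j = c * ∑ i, ∑ j, w i * M i j * w j := by
  simp only [Matrix.smul_apply, smul_eq_mul, Finset.mul_sum]
  exact Finset.sum_congr rfl fun i _ => Finset.sum_congr rfl fun j _ => by ring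

theorem dot_eq_three (u w : Fin 3 → ℝ) : ∑ i, u i * w i = u 0 * w 0 + u 1 * w 1 + u 2 * w 2 := by
  simp [Fin.sum_univ_three]

/-- the `u`-range of the {110} upper step: `γ ∈ [slo/λ, λ]` ⟹ `1/(λγ) ∈ [0.83, 1.002]`. -/
theorem urange {lam γ : ℝ} (hlam : lam ∈ Icc lam0 LamW) (h1 : sloC / lam ≤ γ) (h2 : γ ≤ lam * 1) :
    (83 / 100 : ℝ) ≤ 1 / (lam * γ) ∧ 1 / (lam * γ) ≤ 1002 / 1000 := by
  have hl0 : 0 < lam := lt_of_lt_of_le lam0_pos hlam.1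
  have hslo : (0:ℝ) < sloC := by unfold sloC; norm_num
  have hγ0 : 0 < γ := lt_of_lt_of_le (div_pos hslo hl0) h1
  have hlg : sloC ≤ lam * γ := by rwa [div_le_iff₀ hl0, mul_comm] at h1
  have hlg2 : lam * γ ≤ LamW * LamW :=
    le_trans (mul_le_mul_of_nonneg_left h2 hl0.le) (by rw [mul_one]; exact mul_le_mul hlam.2 hlam.2 hl0.le (by unfold LamW; norm_num))
  have hn1 : (83 / 100 : ℝ) * (LamW * LamW) ≤ 1 := by unfold LamW; norm_num
  have hn2 : (1 : ℝ) ≤ 1002 / 1000 * sloC := by unfold sloC; norm_num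
  constructor
  · rw [le_div_iff₀ (mul_pos hl0 hγ0)]; nlinarith
  · rw [div_le_iff₀ (mul_pos hl0 hγ0)]; nlinarith

/-- the `x`-range of the {110} lower step: `γ ∈ [slo/λ, λ]` ⟹ `γ/λ ∈ [0.83, 1]`. -/
theorem xrange {lam γ : ℝ} (hlam : lam ∈ Icc lam0 LamW) (h1 : sloC / lam ≤ γ) (h2 : γ ≤ lam * 1) :
    (83 / 100 : ℝ) ≤ γ / lam ∧ γ / lam ≤ 1 := by
  have hl0 : 0 < lam := lt_of_lt_of_le lam0_pos hlam.1
  have hll : lam * lam ≤ LamW * LamW := mul_le_mul hlam.2 hlam.2 hl0.le (by unfold LamW; norm_num)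
  have hnum : (83 / 100 : ℝ) * (LamW * LamW) ≤ sloC := by unfold LamW sloC; norm_num
  constructor
  · rw [le_div_iff₀ hl0]
    rw [div_le_iff₀ hl0] at h1
    have h3 : (83 / 100 : ℝ) * lam * lam ≤ γ * lam := by nlinarith
    exact le_of_mul_le_mul_right h3 hl0
  · rw [div_le_one hl0]; linarith

/-- UPPER, class {110}. -/
theorem slot_upper_110 {lam τ : ℝ} (hlam : lam ∈ Icc lam0 LamW) (hτ : τ ∈ Icc 0 τ0c) {S : T4}
    (hI : InInterval Sc lam S) (hO : OddSectorial S τ) (j : Fin 26)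
    (hM : Mq (slots j) = 2) (hT : Tj j = T110)
    (hframe : ∀ u w : Fin 3 → ℝ, u 0 * w 0 + u 1 * w 1 + u 2 * w 2
      = zd (slots j) u * zd (slots j) w + dd (slots j) u * dd (slots j) w / 2 + mdot (slots j) u * mdot (slots j) w / 2)
    (hdm : ∀ w : Fin 3 → ℝ, ∀ s : ℝ, dd (slots j) (fun c => w c - ((slots j).m c : ℝ) * s) = dd (slots j) w)
    (hzP : ∀ w : Fin 3 → ℝ, ∀ s : ℝ, zd (slots j) (fun c => w c - ((slots j).m c : ℝ) * s) = zd (slots j) w)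
    (hI1 : ∀ w : Fin 3 → ℝ, I1m (slots j) w = nsq w - zd (slots j) w ^ 2)
    (hZf : ∀ w : Fin 3 → ℝ, Zf (slots j) w = zd (slots j) w ^ 2) (p : Fin 3 → ℝ) :
    ∑ i, ∑ i', p i * slotQ cubatureWord MB S j i i' * p i'
      ≤ lam / lam0 * (UA * (∑ i, p i ^ 2 - (∑ i, p i * nj j i) ^ 2)
          + UB * (Zf (slots j) p + ((∑ i, p i ^ 2 - (∑ i, p i * nj j i) ^ 2) - Zf (slots j) p) / βd)) := by
  have hn := hn_j j
  have hl1 : 1 ≤ lam := le_trans (by unfold lam0; norm_num) hlam.1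
  have hl0 : 0 < lam := by linarith
  have hslo : (0:ℝ) < sloC := by unfold sloC; norm_num
  have hβd : (0:ℝ) < βd := by rw [βd_eq_sloC]; exact hslo
  have hodd := (abs_sub_le_iff.1 (slot_oddEven hlam hτ hI hO j p)).1
  have hP0 : 0 ≤ ∑ i, p i ^ 2 - (∑ i, p i * nj j i) ^ 2 := by rw [← sum_sq_projPerp_mulVec hn]; positivity
  -- coordinates
  have hPc : ∀ w : Fin 3 → ℝ, ∀ c, (projPerp (nj j)).mulVec w c = w c - ((slots j).m c : ℝ) * (mdot (slots j) w / 2) := by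
    intro w c; rw [projPerp_nj_apply, hM]; ring
  have hPfun : ∀ w : Fin 3 → ℝ, (projPerp (nj j)).mulVec w = fun c => w c - ((slots j).m c : ℝ) * (mdot (slots j) w / 2) :=
    fun w => funext (hPc w)
  have hmm : ((slots j).m 0 : ℝ) ^ 2 + ((slots j).m 1 : ℝ) ^ 2 + ((slots j).m 2 : ℝ) ^ 2 = 2 := by rw [← hM]; rfl
  have hmdP : ∀ w, mdot (slots j) ((projPerp (nj j)).mulVec w) = 0 := by
    intro w; rw [hPfun]; unfold mdot; simp only
    linear_combination (-(((slots j).m 0 : ℝ) * w 0 + (slots j).m 1 * w 1 + (slots j).m 2 * w 2) / 2) * hmm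
  have hzdP : ∀ w, zd (slots j) ((projPerp (nj j)).mulVec w) = zd (slots j) w := fun w => by rw [hPfun]; exact hzP w _
  have hddP : ∀ w, dd (slots j) ((projPerp (nj j)).mulVec w) = dd (slots j) w := fun w => by rw [hPfun]; exact hdm w _
  have hnsq : ∀ w : Fin 3 → ℝ, nsq w = zd (slots j) w ^ 2 + dd (slots j) w ^ 2 / 2 + mdot (slots j) w ^ 2 / 2 := by
    intro w; have h := hframe w w; unfold nsq; linear_combination h
  have hnsqP : ∀ w, nsq ((projPerp (nj j)).mulVec w) = zd (slots j) w ^ 2 + dd (slots j) w ^ 2 / 2 := by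
    intro w; rw [hnsq, hmdP, hzdP, hddP]; ring
  -- the reference form R(w) = wᵀ B̂(Sc,n) w = zd² + βd dd²/2 + mdot²/2
  have hR : ∀ w : Fin 3 → ℝ, ∑ i, ∑ i', w i * regBlock Sc (nj j) i i' * w i'
      = zd (slots j) w ^ 2 + βd * dd (slots j) w ^ 2 / 2 + mdot (slots j) w ^ 2 / 2 := by
    intro w
    rw [regBlock_quad hn, symb_Sc_nj, hI1, hnsqP, hzdP, dot_nj, div_pow, norm_sq_m, hM, βd]
    ring
  -- |P p|² in coordinates
  have hPsq : ∑ i, p i ^ 2 - (∑ i, p i * nj j i) ^ 2 = zd (slots j) p ^ 2 + dd (slots j) p ^ 2 / 2 := by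
    rw [dot_nj_sq, hM, nsq_eq, hnsq p]; ring
  set v := (projPerp (nj j)).mulVec p with hv
  have hvsq : ∑ i, v i ^ 2 = ∑ i, p i ^ 2 - (∑ i, p i * nj j i) ^ 2 := sum_sq_projPerp_mulVec hn p
  -- symmetric part via the per-eigenvalue step
  have hBs : (regBlock (symS S) (nj j)).IsSymm := regBlock_isSymm (oddSmall_symS S) hn
  have hIs := inInterval_symS hI
  have hperpw : ∀ w : Fin 3 → ℝ, ∑ i, nj j i * w i = 0 → ∑ i, w i * nj j i = 0 :=
    fun w hw => by rw [← hw]; exact Finset.sum_congr rfl fun i _ => mul_comm _ _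
  have ha : ∀ w : Fin 3 → ℝ, sloC / lam * ∑ i, w i ^ 2 ≤ ∑ i, ∑ j', w i * regBlock (symS S) (nj j) i j' * w j' :=
    fun w => regBlock_floor_of_inInterval hn hl1 (by rw [div_le_one hl0]; exact le_trans (by unfold sloC; norm_num) hl1)
      (fun w hw => by have h := (nearIso_Sc (nj j) w (hperpw w hw)).1; rw [hn, one_mul] at h; exact h) hIs w
  have hc : ∀ w : Fin 3 → ℝ, ∑ i, ∑ j', w i * regBlock (symS S) (nj j) i j' * w j' ≤ lam * 1 * ∑ i, w i ^ 2 :=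
    fun w => regBlock_ceiling_of_inInterval hn hl1 (by linarith)
      (fun w hw => by have h := (nearIso_Sc (nj j) w (hperpw w hw)).2; rw [hn, one_mul] at h; exact h) hIs w
  have hRle : ∀ w : Fin 3 → ℝ, 1 / lam * ∑ i, ∑ i', w i * regBlock Sc (nj j) i i' * w i'
      ≤ ∑ i, ∑ j', w i * regBlock (symS S) (nj j) i j' * w j' := by
    intro w; have h := regBlock_loewner_lower_of_inInterval hn hl1 hIs w; rwa [sI] at h
  have hT0 : 0 < T110 := by rw [← hT]; exact Tj_pos j
  have hUB : (0:ℝ) ≤ UB := by unfold UB; norm_num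
  set Y := zd (slots j) p ^ 2 + dd (slots j) p ^ 2 / (2 * βd) with hY
  have hYineq : ∀ w : Fin 3 → ℝ, UB * (2 * lam * ∑ i, v i * w i - ∑ i, ∑ i', w i * regBlock Sc (nj j) i i' * w i')
      ≤ lam ^ 2 * UB * Y := by
    intro w
    rw [dot_eq_three, hframe v w, hmdP p, hzdP p, hddP p, hR w]
    have key : lam ^ 2 * Y + (zd (slots j) w ^ 2 + βd * dd (slots j) w ^ 2 / 2 + mdot (slots j) w ^ 2 / 2)
        - 2 * lam * (zd (slots j) p * zd (slots j) w + dd (slots j) p * dd (slots j) w / 2 + 0 * mdot (slots j) w / 2)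
        = (zd (slots j) w - lam * zd (slots j) p) ^ 2 + βd / 2 * (dd (slots j) w - lam * dd (slots j) p / βd) ^ 2
          + mdot (slots j) w ^ 2 / 2 := by
      rw [hY]; field_simp; ring
    have hsos : 0 ≤ (zd (slots j) w - lam * zd (slots j) p) ^ 2 + βd / 2 * (dd (slots j) w - lam * dd (slots j) p / βd) ^ 2
          + mdot (slots j) w ^ 2 / 2 := by positivity
    nlinarith [key, hsos, hUB]
  have hgen := form_qsResp_le_of_eig hBs (fun w => ∑ i, ∑ i', w i * regBlock Sc (nj j) i i' * w i') v hlam.1 (div_pos hslo hl0)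
    ha hc hRle hT0 hUB (fun γ h1 h2 => urange hlam h1 h2) stub_N110U hYineq
  -- assemble
  have hsymform : ∑ i, ∑ i', p i * slotQ cubatureWord MB (symS S) j i i' * p i'
      = ∑ i, ∑ i', v i * qsResp (1 / 2) T110 (regBlock (symS S) (nj j)) i i' * v i' := by
    rw [slotQ_eq, sum_sum_mul_qsResp_regBlock_projPerp hn, hT]
  rw [hsymform] at hodd
  rw [hvsq] at hgen
  have hYeq : Zf (slots j) p + ((∑ i, p i ^ 2 - (∑ i, p i * nj j i) ^ 2) - Zf (slots j) p) / βd = Y := by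
    rw [hZf, hPsq, hY]; field_simp; ring
  rw [hYeq]
  have hll : 1 ≤ lam / lam0 := by rw [le_div_iff₀ lam0_pos, one_mul]; exact hlam.1
  have hE : (0:ℝ) ≤ ellBar := by unfold ellBar; norm_num
  have h2 : ellBar * (∑ i, p i ^ 2 - (∑ i, p i * nj j i) ^ 2) ≤ lam / lam0 * ellBar * (∑ i, p i ^ 2 - (∑ i, p i * nj j i) ^ 2) := by
    apply mul_le_mul_of_nonneg_right _ hP0; nlinarith
  unfold UA
  nlinarith [hodd, hgen, h2]

/-- LOWER, class {110}. -/
theorem slot_lower_110 {lam τ : ℝ} (hlam : lam ∈ Icc lam0 LamW) (hτ : τ ∈ Icc 0 τ0c) {S : T4}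
    (hI : InInterval Sc lam S) (hO : OddSectorial S τ) (j : Fin 26)
    (hM : Mq (slots j) = 2) (hT : Tj j = T110)
    (hzP : ∀ w : Fin 3 → ℝ, ∀ s : ℝ, zd (slots j) (fun c => w c - ((slots j).m c : ℝ) * s) = zd (slots j) w)
    (hI1 : ∀ w : Fin 3 → ℝ, I1m (slots j) w = nsq w - zd (slots j) w ^ 2)
    (hZf : ∀ w : Fin 3 → ℝ, Zf (slots j) w = zd (slots j) w ^ 2) (p : Fin 3 → ℝ) :
    1 / lam * (LA * (∑ i, p i ^ 2 - (∑ i, p i * nj j i) ^ 2)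
        + LB * (βd * (∑ i, p i ^ 2 - (∑ i, p i * nj j i) ^ 2) + (1 - βd) * Zf (slots j) p))
      ≤ ∑ i, ∑ i', p i * slotQ cubatureWord MB S j i i' * p i' := by
  have hn := hn_j j
  have hl1 : 1 ≤ lam := le_trans (by unfold lam0; norm_num) hlam.1
  have hl0 : 0 < lam := by linarith
  have hslo : (0:ℝ) < sloC := by unfold sloC; norm_num
  have hodd := (abs_sub_le_iff.1 (slot_oddEven hlam hτ hI hO j p)).2
  have hP0 : 0 ≤ ∑ i, p i ^ 2 - (∑ i, p i * nj j i) ^ 2 := by rw [← sum_sq_projPerp_mulVec hn]; positivity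
  have hPc : ∀ w : Fin 3 → ℝ, ∀ c, (projPerp (nj j)).mulVec w c = w c - ((slots j).m c : ℝ) * (mdot (slots j) w / 2) := by
    intro w c; rw [projPerp_nj_apply, hM]; ring
  have hPfun : ∀ w : Fin 3 → ℝ, (projPerp (nj j)).mulVec w = fun c => w c - ((slots j).m c : ℝ) * (mdot (slots j) w / 2) :=
    fun w => funext (hPc w)
  have hzdP : ∀ w, zd (slots j) ((projPerp (nj j)).mulVec w) = zd (slots j) w := fun w => by rw [hPfun]; exact hzP w _
  set v := (projPerp (nj j)).mulVec p with hv
  have hvsq : ∑ i, v i ^ 2 = ∑ i, p i ^ 2 - (∑ i, p i * nj j i) ^ 2 := sum_sq_projPerp_mulVec hn p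
  have hvperp : ∑ i, nj j i * v i = 0 := sum_mul_projPerp_mulVec hn p
  have hvperp' : ∑ i, v i * nj j i = 0 := sum_projPerp_mulVec_mul hn p
  -- R v = symb Sc n v = βd |v|² + (1 − βd) Zf p
  have hRv : Torus.symb Sc (nj j) v = βd * (∑ i, p i ^ 2 - (∑ i, p i * nj j i) ^ 2) + (1 - βd) * Zf (slots j) p := by
    rw [symb_Sc_nj, hI1, ← nsq_eq, hvsq, hzdP, hZf, hM, βd]; ring
  have hBs : (regBlock (symS S) (nj j)).IsSymm := regBlock_isSymm (oddSmall_symS S) hn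
  have hIs := inInterval_symS hI
  have hperpw : ∀ w : Fin 3 → ℝ, ∑ i, nj j i * w i = 0 → ∑ i, w i * nj j i = 0 :=
    fun w hw => by rw [← hw]; exact Finset.sum_congr rfl fun i _ => mul_comm _ _
  have ha : ∀ w : Fin 3 → ℝ, sloC / lam * ∑ i, w i ^ 2 ≤ ∑ i, ∑ j', w i * regBlock (symS S) (nj j) i j' * w j' :=
    fun w => regBlock_floor_of_inInterval hn hl1 (by rw [div_le_one hl0]; exact le_trans (by unfold sloC; norm_num) hl1)
      (fun w hw => by have h := (nearIso_Sc (nj j) w (hperpw w hw)).1; rw [hn, one_mul] at h; exact h) hIs w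
  have hc : ∀ w : Fin 3 → ℝ, ∑ i, ∑ j', w i * regBlock (symS S) (nj j) i j' * w j' ≤ lam * 1 * ∑ i, w i ^ 2 :=
    fun w => regBlock_ceiling_of_inInterval hn hl1 (by linarith)
      (fun w hw => by have h := (nearIso_Sc (nj j) w (hperpw w hw)).2; rw [hn, one_mul] at h; exact h) hIs w
  -- vᵀ B̂s v = symb (symS S) n v = symb S n v ≤ λ symb Sc n v
  have hRvle : ∑ i, ∑ i', v i * regBlock (symS S) (nj j) i i' * v i' ≤ lam * Torus.symb Sc (nj j) v := by
    rw [sum_sum_mul_regBlock_mul_of_perp hvperp, symb_symS]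
    have h := hI.2 (nj j) v hvperp'
    rwa [Torus.symb_smul] at h
  have hT0 : 0 < T110 := by rw [← hT]; exact Tj_pos j
  have hLB : LB ≤ 0 := by unfold LB; norm_num
  have hgen := le_form_qsResp_of_eig hBs (fun w => Torus.symb Sc (nj j) w) v hlam.1 (div_pos hslo hl0)
    ha hc hRvle hT0 hLB (fun γ h1 h2 => xrange hlam h1 h2) stub_N110L
  have hsymform : ∑ i, ∑ i', p i * slotQ cubatureWord MB (symS S) j i i' * p i'
      = ∑ i, ∑ i', v i * qsResp (1 / 2) T110 (regBlock (symS S) (nj j)) i i' * v i' := by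
    rw [slotQ_eq, sum_sum_mul_qsResp_regBlock_projPerp hn, hT]
  rw [hsymform] at hodd
  rw [hvsq, hRv] at hgen
  have hE : (0:ℝ) ≤ ellBar := by unfold ellBar; norm_num
  have h2 : ellBar * (∑ i, p i ^ 2 - (∑ i, p i * nj j i) ^ 2) ≤ 1 / lam * (LamW * ellBar) * (∑ i, p i ^ 2 - (∑ i, p i * nj j i) ^ 2) := by
    apply mul_le_mul_of_nonneg_right _ hP0
    rw [one_div, ← div_eq_inv_mul, le_div_iff₀ hl0]
    nlinarith [hlam.2]
  have hsplit : 1 / lam * (LA * (∑ i, p i ^ 2 - (∑ i, p i * nj j i) ^ 2)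
        + LB * (βd * (∑ i, p i ^ 2 - (∑ i, p i * nj j i) ^ 2) + (1 - βd) * Zf (slots j) p))
      = 1 / lam * (LAp * (∑ i, p i ^ 2 - (∑ i, p i * nj j i) ^ 2)
        + LB * (βd * (∑ i, p i ^ 2 - (∑ i, p i * nj j i) ^ 2) + (1 - βd) * Zf (slots j) p))
        - 1 / lam * (LamW * ellBar) * (∑ i, p i ^ 2 - (∑ i, p i * nj j i) ^ 2) := by
    unfold LA; ring
  rw [hsplit]
  linarith [hodd, hgen, h2]


/-! ### §3.8 Per-slot data of the 26-slot word and the class dispatch -/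

/-- `(z × m)·m = 0`: the `dv`-coordinate is blind to shifts along `m` (a polynomial identity). -/
theorem dd_shift (d : SlotData) (w : Fin 3 → ℝ) (s : ℝ) : dd d (fun c => w c - (d.m c : ℝ) * s) = dd d w := by
  unfold dd; ring

theorem slot_class (j : Fin 26) : j.val < 6 ∨ (6 ≤ j.val ∧ j.val < 18) ∨ 18 ≤ j.val := by omega

/-- axes (slots 0–5): `|m|² = 1`, `T = T100`, `Σ m_c² w_c² = (m·w)²`. -/
theorem facts100 (j : Fin 26) (hj : j.val < 6) :
    Mq (slots j) = 1 ∧ Tj j = T100 ∧ ∀ w : Fin 3 → ℝ, I1m (slots j) w = mdot (slots j) w ^ 2 := by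
  fin_cases j <;> norm_num at hj <;> refine ⟨?_, ?_, fun w => ?_⟩ <;>
    simp [slots, Mq, Tj, T100, MB, I1m, mdot, Matrix.cons_val_zero, Matrix.cons_val_one, Matrix.cons_val_two,
      Matrix.head_cons, Matrix.tail_cons]

/-- body diagonals (slots 18–25): `|m|² = 3`, `T = T111`, `Σ m_c² w_c² = |w|²`. -/
theorem facts111 (j : Fin 26) (hj : 18 ≤ j.val) :
    Mq (slots j) = 3 ∧ Tj j = T111 ∧ ∀ w : Fin 3 → ℝ, I1m (slots j) w = nsq w := by
  fin_cases j <;> norm_num at hj <;> refine ⟨?_, ?_, fun w => ?_⟩ <;>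
    simp [slots, Mq, Tj, T111, MB, I1m, nsq, Matrix.cons_val_zero, Matrix.cons_val_one, Matrix.cons_val_two,
      Matrix.head_cons, Matrix.tail_cons] <;> ring

/-- face diagonals (slots 6–17): `|m|² = 2`, `T = T110`, the polar frame identity, `z ⊥ m`-shift invariance,
`Σ m_c² w_c² = |w|² − (z·w)²`, `Zf = (z·w)²`. -/
theorem facts110 (j : Fin 26) (hj : 6 ≤ j.val ∧ j.val < 18) :
    Mq (slots j) = 2 ∧ Tj j = T110 ∧
    (∀ u w : Fin 3 → ℝ, u 0 * w 0 + u 1 * w 1 + u 2 * w 2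
      = zd (slots j) u * zd (slots j) w + dd (slots j) u * dd (slots j) w / 2 + mdot (slots j) u * mdot (slots j) w / 2) ∧
    (∀ w : Fin 3 → ℝ, ∀ s : ℝ, zd (slots j) (fun c => w c - ((slots j).m c : ℝ) * s) = zd (slots j) w) ∧
    (∀ w : Fin 3 → ℝ, I1m (slots j) w = nsq w - zd (slots j) w ^ 2) ∧
    (∀ w : Fin 3 → ℝ, Zf (slots j) w = zd (slots j) w ^ 2) := by
  fin_cases j <;> norm_num at hj <;> refine ⟨?_, ?_, fun u w => ?_, fun w s => ?_, fun w => ?_, fun w => ?_⟩ <;>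
    simp [slots, Mq, Tj, T110, MB, zv, zd, dd, mdot, I1m, Zf, nsq, Matrix.cons_val_zero, Matrix.cons_val_one,
      Matrix.cons_val_two, Matrix.head_cons, Matrix.tail_cons] <;> ring

/-- **Per-slot UPPER bound** (was `stub_slot_upper` in v1): `pᵀ Q_j(S) p ≤ (λ/λ₀)·uForm_j(p)` on the certificate window. -/
theorem slot_upper {lam τ : ℝ} (hlam : lam ∈ Icc lam0 LamW) (hτ : τ ∈ Icc 0 τ0c) {S : T4}
    (hI : InInterval Sc lam S) (hO : OddSectorial S τ) (j : Fin 26) (p : Fin 3 → ℝ) :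
    ∑ i, ∑ i', p i * slotQ cubatureWord MB S j i i' * p i' ≤ lam / lam0 * uForm (slots j) p := by
  rcases slot_class j with hj | hj | hj
  · obtain ⟨hM, hT, hI1⟩ := facts100 j hj
    have hwin : ∀ w : Fin 3 → ℝ, ∑ i, nj j i * w i = 0 → Torus.symb Sc (nj j) w = 1 * ∑ i, w i ^ 2 := by
      intro w hw; rw [symb_Sc_nj, hI1, (perp_iff j w).1 hw, nsq_eq]; ring
    have h := slot_upper_scalar hlam hτ hI hO j one_pos le_rfl hwin (Up := U100p) (by rw [hT]; exact stub_N100U) p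
    rw [perp_sq, hM] at h
    calc _ ≤ _ := h
      _ = lam / lam0 * uForm (slots j) p := by unfold uForm qLag qA1 U100; rw [hM]; ring
  · obtain ⟨hM, hT, hframe, hzP, hI1, hZf⟩ := facts110 j hj
    have h := slot_upper_110 hlam hτ hI hO j hM hT hframe (dd_shift (slots j)) hzP hI1 hZf p
    rw [perp_sq, hM] at h
    have hβ : βd ≠ 0 := by rw [βd_eq_sloC]; unfold sloC; norm_num
    calc _ ≤ _ := h
      _ = lam / lam0 * uForm (slots j) p := by unfold uForm qLag qA2 qB2; rw [hM]; field_simp; ring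
  · obtain ⟨hM, hT, hI1⟩ := facts111 j hj
    have hwin : ∀ w : Fin 3 → ℝ, ∑ i, nj j i * w i = 0 → Torus.symb Sc (nj j) w = β111 * ∑ i, w i ^ 2 := by
      intro w _; rw [symb_Sc_nj, hI1, nsq_eq, hM, β111]; ring
    have h := slot_upper_scalar hlam hτ hI hO j (α := β111) (by unfold β111 κc; norm_num) (by unfold β111 κc; norm_num) hwin
      (Up := U111p) (by rw [hT]; exact stub_N111U) p
    rw [perp_sq, hM] at h
    calc _ ≤ _ := h
      _ = lam / lam0 * uForm (slots j) p := by unfold uForm qLag qA3 U111; rw [hM]; ring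

/-- **Per-slot LOWER bound** (was `stub_slot_lower` in v1): `lForm_j(p)/λ ≤ pᵀ Q_j(S) p` on the certificate window. -/
theorem slot_lower {lam τ : ℝ} (hlam : lam ∈ Icc lam0 LamW) (hτ : τ ∈ Icc 0 τ0c) {S : T4}
    (hI : InInterval Sc lam S) (hO : OddSectorial S τ) (j : Fin 26) (p : Fin 3 → ℝ) :
    lForm (slots j) p / lam ≤ ∑ i, ∑ i', p i * slotQ cubatureWord MB S j i i' * p i' := by
  rcases slot_class j with hj | hj | hj
  · obtain ⟨hM, hT, hI1⟩ := facts100 j hj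
    have hwin : ∀ w : Fin 3 → ℝ, ∑ i, nj j i * w i = 0 → Torus.symb Sc (nj j) w = 1 * ∑ i, w i ^ 2 := by
      intro w hw; rw [symb_Sc_nj, hI1, (perp_iff j w).1 hw, nsq_eq]; ring
    have h := slot_lower_scalar hlam hτ hI hO j one_pos (by unfold lam0; norm_num) hwin (Lp := L100p) (by rw [hT]; exact stub_N100L) p
    rw [perp_sq, hM] at h
    calc lForm (slots j) p / lam = _ := by unfold lForm qLag lA1 L100; rw [hM]; ring
      _ ≤ _ := h
  · obtain ⟨hM, hT, hframe, hzP, hI1, hZf⟩ := facts110 j hj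
    have h := slot_lower_110 hlam hτ hI hO j hM hT hzP hI1 hZf p
    rw [perp_sq, hM] at h
    calc lForm (slots j) p / lam = _ := by unfold lForm qLag lA2 lB2; rw [hM]; ring
      _ ≤ _ := h
  · obtain ⟨hM, hT, hI1⟩ := facts111 j hj
    have hwin : ∀ w : Fin 3 → ℝ, ∑ i, nj j i * w i = 0 → Torus.symb Sc (nj j) w = β111 * ∑ i, w i ^ 2 := by
      intro w _; rw [symb_Sc_nj, hI1, nsq_eq, hM, β111]; ring
    have h := slot_lower_scalar hlam hτ hI hO j (α := β111) (by unfold β111 κc; norm_num) (by unfold β111 κc lam0; norm_num) hwin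
      (Lp := L111p) (by rw [hT]; exact stub_N111L) p
    rw [perp_sq, hM] at h
    calc lForm (slots j) p / lam = _ := by unfold lForm qLag lA3 L111; rw [hM]; ring
      _ ≤ _ := h



/-! ## §4 Symbol bounds for `ΦB aB` on the interval -/

theorem symb_ΦB (a : ℝ) (S : T4) (k p : Fin 3 → ℝ) :
    Torus.symb (ΦB a S) k p = a * ∑ j, slotCoef cubatureWord j * (∑ a', (cubatureWord.phase j).e a' * k a') ^ 2 *
      ∑ i, ∑ i', p i * slotQ cubatureWord MB S j i i' * p i' := by
  show Torus.symb (a • excQS cubatureWord MB S) k p = _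
  rw [Torus.symb_smul, symb_excQS]

theorem lam_pos_of_mem {lam : ℝ} (hlam : lam ∈ Icc lam0 LamW) : 0 < lam :=
  lt_of_lt_of_le lam0_pos hlam.1

/-- UPPER: `symb (ΦB aB S) ≤ (λ/λ₀)·aHat·(u₁I₁ + u₂I₂ + u₃I₃)`. -/
theorem symb_ΦB_le {lam τ : ℝ} (hlam : lam ∈ Icc lam0 LamW) (hτ : τ ∈ Icc 0 τ0c) {S : T4}
    (hI : InInterval Sc lam S) (hO : OddSectorial S τ) (k p : Fin 3 → ℝ) :
    Torus.symb (ΦB aB S) k p ≤ lam / lam0 * aHat * (u1 * I1 k p + u2 * I2 k p + u3 * I3 k p) := by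
  rw [symb_ΦB]
  have hsum : ∑ j, slotCoef cubatureWord j * (∑ a', (cubatureWord.phase j).e a' * k a') ^ 2 *
        ∑ i, ∑ i', p i * slotQ cubatureWord MB S j i i' * p i'
      ≤ ∑ j, slotCoef cubatureWord j * (∑ a', (cubatureWord.phase j).e a' * k a') ^ 2 * (lam / lam0 * uForm (slots j) p) := by
    apply Finset.sum_le_sum
    intro j _
    exact mul_le_mul_of_nonneg_left (slot_upper hlam hτ hI hO j p) (mul_nonneg (slotCoef_nonneg _ _) (sq_nonneg _))
  have hid : ∑ j, slotCoef cubatureWord j * (∑ a', (cubatureWord.phase j).e a' * k a') ^ 2 * (lam / lam0 * uForm (slots j) p)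
      = lam / lam0 / (2 * (2 * π) ^ 4 * 3720) * ∑ j, kCoef (slots j) k * uForm (slots j) p := by
    rw [Finset.mul_sum]
    refine Finset.sum_congr rfl fun j _ => ?_
    rw [slotCoef_mul_sq]
    ring
  rw [hid, sum_kCoef_uForm] at hsum
  have hπ : (0:ℝ) < 2 * (2 * π) ^ 4 * 3720 := by positivity
  calc aB * _ ≤ aB * (lam / lam0 / (2 * (2 * π) ^ 4 * 3720) * (u1 * I1 k p + u2 * I2 k p + u3 * I3 k p)) :=
        mul_le_mul_of_nonneg_left hsum aB_pos.le
    _ = lam / lam0 * aHat * (u1 * I1 k p + u2 * I2 k p + u3 * I3 k p) := by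
        unfold aB; field_simp

/-- LOWER: `(1/λ)·aHat·(l₁I₁ + l₂I₂ + l₃I₃) ≤ symb (ΦB aB S)`. -/
theorem le_symb_ΦB {lam τ : ℝ} (hlam : lam ∈ Icc lam0 LamW) (hτ : τ ∈ Icc 0 τ0c) {S : T4}
    (hI : InInterval Sc lam S) (hO : OddSectorial S τ) (k p : Fin 3 → ℝ) :
    1 / lam * aHat * (l1 * I1 k p + l2 * I2 k p + l3 * I3 k p) ≤ Torus.symb (ΦB aB S) k p := by
  rw [symb_ΦB]
  have hsum : ∑ j, slotCoef cubatureWord j * (∑ a', (cubatureWord.phase j).e a' * k a') ^ 2 * (lForm (slots j) p / lam)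
      ≤ ∑ j, slotCoef cubatureWord j * (∑ a', (cubatureWord.phase j).e a' * k a') ^ 2 *
        ∑ i, ∑ i', p i * slotQ cubatureWord MB S j i i' * p i' := by
    apply Finset.sum_le_sum
    intro j _
    exact mul_le_mul_of_nonneg_left (slot_lower hlam hτ hI hO j p) (mul_nonneg (slotCoef_nonneg _ _) (sq_nonneg _))
  have hid : ∑ j, slotCoef cubatureWord j * (∑ a', (cubatureWord.phase j).e a' * k a') ^ 2 * (lForm (slots j) p / lam)
      = 1 / lam / (2 * (2 * π) ^ 4 * 3720) * ∑ j, kCoef (slots j) k * lForm (slots j) p := by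
    rw [Finset.mul_sum]
    refine Finset.sum_congr rfl fun j _ => ?_
    rw [slotCoef_mul_sq]
    ring
  rw [hid, sum_kCoef_lForm] at hsum
  have hπ : (0:ℝ) < 2 * (2 * π) ^ 4 * 3720 := by positivity
  calc 1 / lam * aHat * (l1 * I1 k p + l2 * I2 k p + l3 * I3 k p)
      = aB * (1 / lam / (2 * (2 * π) ^ 4 * 3720) * (l1 * I1 k p + l2 * I2 k p + l3 * I3 k p)) := by
        unfold aB; field_simp
    _ ≤ aB * _ := mul_le_mul_of_nonneg_left hsum aB_pos.le

/-! ## §5 The finite certificate: four sign conditions on rationals -/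

theorem certU_signs : aHat * u2 * (1 + δc) ≤ lam0 ∧ aHat * (u1 - u3) * (1 + δc) ≤ lam0 * (1 + κc) := by
  unfold δc aHat u1 u2 u3 qA1 qA2 qA3 qB2 U100 U111 UA UB U100p U111p UAp ellBar βd lam0 κc; constructor <;> norm_num

theorem certL_signs : 1 + δc ≤ aHat * l2 ∧ (1 + δc) * (1 + κc) ≤ aHat * (l1 - l3) := by
  unfold δc aHat l1 l2 l3 lA1 lA2 lA3 lB2 L100 L111 LA LB L100p L111p LAp ellBar LamW βd κc; constructor <;> norm_num

/-- UPPER face on transverse pairs: `(aHat/λ₀)(u₁I₁+u₂I₂+u₃I₃) ≤ symb Sc/(1+δ)`. -/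
theorem certU {k p : Fin 3 → ℝ} (h : ∑ i, p i * k i = 0) :
    aHat / lam0 * (u1 * I1 k p + u2 * I2 k p + u3 * I3 k p) ≤ Torus.symb Sc k p / (1 + δc) := by
  have hδ : (0:ℝ) < 1 + δc := by unfold δc; norm_num
  rw [symb_Sc, Nkp_eq, I3_eq_of_perp h, div_mul_eq_mul_div, div_le_div_iff₀ lam0_pos hδ]
  obtain ⟨hA, hB⟩ := certU_signs
  have h1 := I1_nonneg k p; have h2 := I2_nonneg k p
  nlinarith [mul_le_mul_of_nonneg_right hA h2, mul_le_mul_of_nonneg_right hB h1]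

/-- LOWER face on transverse pairs: `(1+δ) symb Sc ≤ aHat (l₁I₁+l₂I₂+l₃I₃)`. -/
theorem certL {k p : Fin 3 → ℝ} (h : ∑ i, p i * k i = 0) :
    (1 + δc) * Torus.symb Sc k p ≤ aHat * (l1 * I1 k p + l2 * I2 k p + l3 * I3 k p) := by
  rw [symb_Sc, Nkp_eq, I3_eq_of_perp h]
  obtain ⟨hA, hB⟩ := certL_signs
  have h1 := I1_nonneg k p; have h2 := I2_nonneg k p
  nlinarith [mul_le_mul_of_nonneg_right hA h2, mul_le_mul_of_nonneg_right hB h1]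

/-! ## §6 Assembly: the even clause with slack, and `EvenSlackWindowB aB ρB` -/

/-- THE EVEN CLAUSE WITH SLACK about `Sc` on `[λ₀, Λ_w] × [0, τ₀]`. -/
theorem evenSlackOnInterval_cert : EvenSlackOnInterval (ΦB aB) Sc lam0 LamW τ0c δc := by
  intro lam hlam S τ hτ hI hO
  have hlam0 : 0 < lam := lam_pos_of_mem hlam
  have hδ : (0:ℝ) < 1 + δc := by unfold δc; norm_num
  constructor
  · intro k p hkp
    rw [Torus.symb_smul]
    have hc := certL hkp
    have hlo := le_symb_ΦB hlam hτ hI hO k p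
    have e : 1 / (lam / (1 + δc)) * Torus.symb Sc k p = (1 / lam) * ((1 + δc) * Torus.symb Sc k p) := by
      field_simp
    rw [e]
    calc 1 / lam * ((1 + δc) * Torus.symb Sc k p) ≤ 1 / lam * (aHat * (l1 * I1 k p + l2 * I2 k p + l3 * I3 k p)) :=
          mul_le_mul_of_nonneg_left hc (by positivity)
      _ = 1 / lam * aHat * (l1 * I1 k p + l2 * I2 k p + l3 * I3 k p) := by ring
      _ ≤ _ := hlo
  · intro k p hkp
    rw [Torus.symb_smul]
    have hc := certU hkp
    have hup := symb_ΦB_le hlam hτ hI hO k p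
    calc Torus.symb (ΦB aB S) k p ≤ lam / lam0 * aHat * (u1 * I1 k p + u2 * I2 k p + u3 * I3 k p) := hup
      _ = lam * (aHat / lam0 * (u1 * I1 k p + u2 * I2 k p + u3 * I3 k p)) := by ring
      _ ≤ lam * (Torus.symb Sc k p / (1 + δc)) := mul_le_mul_of_nonneg_left hc hlam0.le
      _ = lam / (1 + δc) * Torus.symb Sc k p := by ring

/-- `EvenSlackWindowB aB ρB` with the explicit window numbers (all side conditions by `norm_num`). -/
theorem evenSlackWindowB_cert : EvenSlackWindowB aB ρB := by
  refine ⟨Sc, sloC, 1, lam0, LamW, lam0, LamV, τ0c, δc, nearIso_Sc, ?_, ?_, le_rfl, ?_, inInterval_Sc_iso, ?_, ?_, ?_, le_rfl, ?_, ?_, ?_, ?_,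
    ?_, ?_, ?_, ?_, evenSlackOnInterval_cert⟩
  all_goals norm_num [sloC, lam0, LamW, LamV, τ0c, δc, ρB]

/-- **THE STATEMENT OF `WCrossing.stub_W_evenSlackB`, from the two per-slot stubs.** -/
theorem W_evenSlackB : ∃ a > (0:ℝ), EvenSlackWindowB a ρB := ⟨aB, aB_pos, evenSlackWindowB_cert⟩

end

end Summit.AnomalousDissipation.AnomalousDissipation.Cruxes.LagrangianRenormalisationStep.WEvenCert
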